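import Mathlib
import Literature.Analysis.Complex.RiemannMapping
import Literature.Analysis.Complex.SchurAlgorithm
import HarnessLib

/-!
# Taylor coefficients of Schur functions: the Schwarz–Pick coefficient inequalities (McKee–Smyth Prop. 12.11) and the Parseval / Hardy contraction inequality (re-homed proofs)

Complex-analysis support for Smyth's theorem on the Mahler measure of nonreciprocal polynomials, RE-HOMED into
`Literature/` by the Hodge foundations lane (`lit-hodgefound`, seat p20, generation 36) from the venture cell
`pub-namedobj` (seat `pub-namedobj-mahler`, gens 7–8): verbatim ports, in dependency order and each with its original module
docstring (Parts 1–7), of the modules `Summits/Ventures/DiscreteObjects/Mahler/{TaylorJet, TaylorJetProduct, SchwarzPickCoeff,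
NonreciprocalMeasureBound (its five rotation-average lemmas only), SchwarzPickHigher, HardyContraction, Parseval4}.lean`,
namespace `Summit.Ventures.DiscreteObjects.Mahler` re-rooted as `Literature.Analysis.Complex` (this file's path namespace).

CONTENT (McKee–Smyth, *Around the Unit Circle*, §12.1.1 and Appendix C): Taylor coefficients `cₙ = jetCoeff F n` of a function on
the unit disc through iterated `dslope` (the expansion (12.3)), their algebra (sums, products, `z^k`-shifts, the rotation averages
`f_k` of Proposition 12.7), the Schwarz–Pick coefficient inequalities of Proposition 12.11 (b)–(d) for Schur functions
(`IsSchurClass.norm_jetCoeff_le : ‖c_k‖ ≤ 1 − ‖c₀‖²`, `IsSchurClass.norm_jetCoeff_two_mul_le`,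
`IsSchurClass.jetCoeff_two_mul_real_bounds`), and the Parseval / Hardy-space contraction inequality
`hardy_contraction : Σ_{n<N} ‖[zⁿ](p·F)‖² ≤ Σ ‖pₙ‖²` for a polynomial `p` and a Schur function `F` (Proposition 12.11 (a) with
Parseval's identity, Theorem C.2), with its four-term real specialisation `parseval4` used in §12.2.2.

DESIGN: the cell's two-field structure `IsSchur F` (holomorphic on `ball 0 1`, bounded by `1` there) is NOT re-declared: it is,
field for field, the tree's `Literature.Analysis.Complex.SchurAlgorithm.IsSchurClass` (`SchurAlgorithm.lean`, a conjunction), which this file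
REUSES — the two projections `IsSchurClass.differentiableOn` / `IsSchurClass.norm_le` are added so that the ported proofs read
verbatim, and the dot-notation lemmas land in `namespace SchurAlgorithm.IsSchurClass`.  Definitions kept from the source (with bodies, verbatim):
`jetTail`, `jetCoeff`, `jetPoly`, `circPt`.  Theorems only otherwise; no named fact; imports Mathlib/Literature only; every
declaration carries the citation of the step of [McKee–Smyth] it formalises (the Summits originals carry docstrings without tags).
The Summits originals stay in place (transitional duplication; twins = same short names in `Summit.Ventures.DiscreteObjects.Mahler`).
Consumer: the sibling port `Literature/NumberTheory/MahlerMeasure/SmythNonreciprocalTheorem.lean` (Smyth's theorem `M(P) ≥ θ₀`,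
discharging the named fact `Literature.NumberTheory.MahlerMeasure.NonreciprocalMahlerBound`).
-/

noncomputable section

/-!
## Part 1 — port of `Summits/Ventures/DiscreteObjects/Mahler/TaylorJet.lean` (24 declarations kept)

# Taylor jets at the origin for functions holomorphic on a disc (venture `DiscreteObjects`, target L)

Cell `pub-namedobj`, seat `pub-namedobj-mahler` (gen 8). Framing: lottery ticket; floor = certified
bounds/negative ranges.

Infrastructure for the in-tree proof of Smyth's theorem (`M(P) ≥ θ₀` for nonreciprocal `P ∈ ℤ[X]`,
[McKee–Smyth, *Around the Unit Circle*, Thm 12.1]): the proof manipulates finitely many Taylor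
coefficients of bounded holomorphic functions on the unit disc.  We set up an elementary "jet calculus"
at `0` that avoids formal power series:

* `jetTail F n` — the `n`-th iterated divided difference `dslope · 0` of `F`; `jetCoeff F n = jetTail F n 0`
  is the `n`-th Taylor coefficient;
* `jet_eq` — the EXACT Taylor formula `F z = Σ_{n<N} jetCoeff F n · zⁿ + z^N · jetTail F N z`, valid for
  every function and every `z` (pure algebra of `dslope`);
* `differentiableOn_jetTail` — tails of a function holomorphic on `ball 0 r` are holomorphic there
  (removable singularities, `Complex.differentiableOn_dslope`);
* `jetCoeff_unique` — uniqueness: an expansion `F z = Σ_{n<N} cₙ zⁿ + z^N ψ z` off `0` with `ψ` bounded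
  near `0` forces `jetCoeff F n = cₙ` (`n < N`);
* linearity (`jetCoeff_add`, `jetCoeff_const_mul`, `jetCoeff_const`, …), the product rule
  `jetCoeff_mul` (Cauchy product, via `Polynomial`), rotations `jetCoeff_comp_mul_left` and the
  rotation average `jetCoeff_rotAvg` (`k⁻¹ Σ_{j<k} F(ωʲ z)` keeps exactly the coefficients of index
  divisible by `k`), flat functions `eq_jetCoeff_zero_add_pow_mul`.
-/

section Part1

namespace Literature.Analysis.Complex

open Literature.Analysis.Complex.SchurAlgorithm

open _root_.Polynomial _root_.Metric _root_.Filter _root_.Topology _root_.Asymptotics _root_.Finset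

noncomputable section

/-! ### Definitions and the exact Taylor formula -/

/-- Iterated divided differences at `0`: `jetTail F 0 = F`, `jetTail F (n+1) = dslope (jetTail F n) 0`.
[cite: MckeeSmyth2021, §12.1.1 (12.3) p.206] -/
def jetTail (F : ℂ → ℂ) (n : ℕ) : ℂ → ℂ := (fun G : ℂ → ℂ => dslope G 0)^[n] F

/-- The `n`-th Taylor coefficient of `F` at `0`. [cite: MckeeSmyth2021, §12.1.1 (12.3) p.206] -/
def jetCoeff (F : ℂ → ℂ) (n : ℕ) : ℂ := jetTail F n 0

/-- `jetTail F 0 = F`. [cite: MckeeSmyth2021, §12.1.1 (12.3) p.206] -/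
theorem jetTail_zero (F : ℂ → ℂ) : jetTail F 0 = F := rfl

/-- `jetTail F (n+1) = dslope (jetTail F n) 0`. [cite: MckeeSmyth2021, §12.1.1 (12.3) p.206] -/
theorem jetTail_succ (F : ℂ → ℂ) (n : ℕ) : jetTail F (n + 1) = dslope (jetTail F n) 0 := by
  rw [jetTail, Function.iterate_succ_apply']; rfl

/-- `jetTail F (n+1) = jetTail (dslope F 0) n`. [cite: MckeeSmyth2021, §12.1.1 (12.3) p.206] -/
theorem jetTail_succ' (F : ℂ → ℂ) (n : ℕ) : jetTail F (n + 1) = jetTail (dslope F 0) n := by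
  rw [jetTail, Function.iterate_succ_apply]; rfl

/-- Tails compose additively in the index. [cite: MckeeSmyth2021, §12.1.1 (12.3) p.206] -/
theorem jetTail_add (F : ℂ → ℂ) (m n : ℕ) : jetTail F (m + n) = jetTail (jetTail F m) n := by
  rw [jetTail, jetTail, jetTail, add_comm, Function.iterate_add_apply]

/-- The zeroth coefficient is the value at `0`. [cite: MckeeSmyth2021, §12.1.1 (12.3) p.206] -/
theorem jetCoeff_zero (F : ℂ → ℂ) : jetCoeff F 0 = F 0 := rfl

/-- Coefficients of `F` are shifted coefficients of `dslope F 0`. [cite: MckeeSmyth2021, §12.1.1 (12.3) p.206] -/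
theorem jetCoeff_succ' (F : ℂ → ℂ) (n : ℕ) : jetCoeff F (n + 1) = jetCoeff (dslope F 0) n := by
  rw [jetCoeff, jetTail_succ']; rfl

/-- `jetCoeff F (m+n)` is the `n`-th coefficient of the `m`-th tail. [cite: MckeeSmyth2021, §12.1.1 (12.3) p.206] -/
theorem jetCoeff_add_index (F : ℂ → ℂ) (m n : ℕ) :
    jetCoeff F (m + n) = jetCoeff (jetTail F m) n := by
  rw [jetCoeff, jetCoeff, jetTail_add]

/-- Coefficients of a tail are shifted coefficients. [cite: MckeeSmyth2021, §12.1.1 (12.3) p.206] -/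
theorem jetCoeff_jetTail (F : ℂ → ℂ) (m n : ℕ) :
    jetCoeff (jetTail F m) n = jetCoeff F (m + n) := (jetCoeff_add_index F m n).symm

/-- The value of a tail at `0` is the corresponding coefficient. [cite: MckeeSmyth2021, §12.1.1 (12.3) p.206] -/
theorem jetTail_apply_zero (F : ℂ → ℂ) (n : ℕ) : jetTail F n 0 = jetCoeff F n := rfl

/-- One step of the Taylor formula: `jetTail F N z = jetCoeff F N + z · jetTail F (N+1) z`.
[cite: MckeeSmyth2021, §12.1.1 (12.3) p.206] -/
theorem jetTail_eq_coeff_add (F : ℂ → ℂ) (N : ℕ) (z : ℂ) :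
    jetTail F N z = jetCoeff F N + z * jetTail F (N + 1) z := by
  have h := sub_smul_dslope (jetTail F N) 0 z
  rw [sub_zero, smul_eq_mul] at h
  rw [jetTail_succ, h, jetCoeff]; ring

/-- **Exact Taylor formula** (no hypotheses): `F z = Σ_{n<N} jetCoeff F n zⁿ + z^N jetTail F N z`.
[cite: MckeeSmyth2021, §12.1.1 (12.3) p.206] -/
theorem jet_eq (F : ℂ → ℂ) (N : ℕ) (z : ℂ) :
    F z = (∑ n ∈ range N, jetCoeff F n * z ^ n) + z ^ N * jetTail F N z := by
  induction N with
  | zero => simp [jetTail_zero]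
  | succ N ih => rw [ih, sum_range_succ, jetTail_eq_coeff_add F N z]; ring

/-- A flat function: if the coefficients of index `1, …, k-1` vanish then `F z = c₀ + z^k · jetTail F k z`.
[cite: MckeeSmyth2021, §12.1.1 (12.3) p.206] -/
theorem eq_jetCoeff_zero_add_pow_mul (F : ℂ → ℂ) {k : ℕ} (hk : 1 ≤ k)
    (hflat : ∀ n, 0 < n → n < k → jetCoeff F n = 0) (z : ℂ) :
    F z = jetCoeff F 0 + z ^ k * jetTail F k z := by
  rw [jet_eq F k z]
  congr 1
  rw [Finset.sum_eq_single_of_mem 0 (Finset.mem_range.mpr (by omega))]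
  · simp
  · intro n hn hn0
    rw [hflat n (Nat.pos_of_ne_zero hn0) (Finset.mem_range.mp hn), zero_mul]

/-! ### Holomorphy of the tails -/

/-- Tails of a function holomorphic on `ball 0 r` are holomorphic there.
[cite: MckeeSmyth2021, §12.1.1 (12.3) p.206] -/
theorem differentiableOn_jetTail {F : ℂ → ℂ} {r : ℝ} (hr : 0 < r)
    (hF : DifferentiableOn ℂ F (ball 0 r)) (n : ℕ) : DifferentiableOn ℂ (jetTail F n) (ball 0 r) := by
  induction n with
  | zero => exact hF
  | succ n ih =>
    rw [jetTail_succ]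
    exact (Complex.differentiableOn_dslope (ball_mem_nhds _ hr)).mpr ih

/-- Tails of a function holomorphic on `ball 0 r` are continuous at `0`.
[cite: MckeeSmyth2021, §12.1.1 (12.3) p.206] -/
theorem continuousAt_jetTail {F : ℂ → ℂ} {r : ℝ} (hr : 0 < r)
    (hF : DifferentiableOn ℂ F (ball 0 r)) (n : ℕ) : ContinuousAt (jetTail F n) 0 :=
  ((differentiableOn_jetTail hr hF n).differentiableAt (ball_mem_nhds _ hr)).continuousAt

/-- A function continuous at `0` is bounded on punctured neighbourhoods of `0`.
[cite: MckeeSmyth2021, §12.1.1 (12.3) p.206] -/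
theorem isBigO_one_of_continuousAt {ψ : ℂ → ℂ} (h : ContinuousAt ψ 0) :
    ψ =O[𝓝[≠] (0 : ℂ)] (fun _ => (1 : ℝ)) :=
  (h.tendsto.mono_left nhdsWithin_le_nhds).isBigO_one ℝ

/-- The constant term of an expansion `F z = c₀ + z · B z` (off `0`, `B` bounded near `0`) of a function
continuous at `0` is `F 0`. [cite: MckeeSmyth2021, §12.1.1 (12.3) p.206] -/
theorem apply_zero_eq_of_expansion {F B : ℂ → ℂ} {c₀ : ℂ} (hF : ContinuousAt F 0)
    (hB : B =O[𝓝[≠] (0 : ℂ)] (fun _ => (1 : ℝ)))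
    (h : ∀ᶠ z in 𝓝[≠] (0 : ℂ), F z = c₀ + z * B z) : F 0 = c₀ := by
  have h1 : Tendsto (fun z => F z - c₀) (𝓝[≠] (0 : ℂ)) (𝓝 (F 0 - c₀)) :=
    ((hF.tendsto.sub tendsto_const_nhds).mono_left nhdsWithin_le_nhds)
  have hz : Tendsto (fun z : ℂ => z) (𝓝[≠] (0 : ℂ)) (𝓝 0) :=
    (continuous_id.tendsto 0).mono_left nhdsWithin_le_nhds
  have h2 : (fun z : ℂ => z * B z) =o[𝓝[≠] (0 : ℂ)] (fun _ => (1 : ℝ)) := by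
    have hz' : (fun z : ℂ => z) =o[𝓝[≠] (0 : ℂ)] (fun _ => (1 : ℝ)) :=
      (isLittleO_one_iff ℝ).mpr hz
    simpa using hz'.mul_isBigO hB
  have h3 : Tendsto (fun z : ℂ => z * B z) (𝓝[≠] (0 : ℂ)) (𝓝 0) := (isLittleO_one_iff ℝ).mp h2
  have h4 : Tendsto (fun z => F z - c₀) (𝓝[≠] (0 : ℂ)) (𝓝 0) := by
    refine h3.congr' ?_
    filter_upwards [h] with z hz
    rw [hz]; ring
  have := tendsto_nhds_unique h1 h4
  exact sub_eq_zero.mp this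

/-- **Uniqueness of Taylor coefficients.** If `F` is holomorphic on `ball 0 r` and
`F z = Σ_{n<N} c n zⁿ + z^N ψ z` for `z ≠ 0` in the ball, with `ψ` bounded near `0`, then
`jetCoeff F n = c n` for all `n < N`. [cite: MckeeSmyth2021, §12.1.1 (12.3) p.206] -/
theorem jetCoeff_unique {r : ℝ} (hr : 0 < r) {ψ : ℂ → ℂ}
    (hψ : ψ =O[𝓝[≠] (0 : ℂ)] (fun _ => (1 : ℝ))) :
    ∀ (N : ℕ) (F : ℂ → ℂ) (c : ℕ → ℂ), DifferentiableOn ℂ F (ball 0 r) →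
      (∀ z ∈ ball (0 : ℂ) r, z ≠ 0 → F z = (∑ n ∈ range N, c n * z ^ n) + z ^ N * ψ z) →
      ∀ n < N, jetCoeff F n = c n := by
  intro N
  induction N with
  | zero => intro F c _ _ n hn; omega
  | succ N ih =>
    intro F c hF h n hn
    have hball : ball (0 : ℂ) r ∈ 𝓝 (0 : ℂ) := ball_mem_nhds _ hr
    have hmem : {(0 : ℂ)}ᶜ ∩ ball (0 : ℂ) r ∈ 𝓝[≠] (0 : ℂ) := inter_mem_nhdsWithin _ hball
    -- the expansion rewritten as `F z = c 0 + z * B z`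
    set B : ℂ → ℂ := fun z => (∑ m ∈ range N, c (m + 1) * z ^ m) + z ^ N * ψ z with hB
    have hexp : ∀ z ∈ ball (0 : ℂ) r, z ≠ 0 → F z = c 0 + z * B z := by
      intro z hz hz0
      rw [h z hz hz0, hB]
      simp only
      rw [Finset.sum_range_succ', mul_add, Finset.mul_sum]
      have : ∀ m ∈ range N, z * (c (m + 1) * z ^ m) = c (m + 1) * z ^ (m + 1) := by
        intro m _; ring
      rw [Finset.sum_congr rfl this]; ring
    have hBO : B =O[𝓝[≠] (0 : ℂ)] (fun _ => (1 : ℝ)) := by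
      have hpoly : ContinuousAt (fun z : ℂ => ∑ m ∈ range N, c (m + 1) * z ^ m) 0 := by fun_prop
      have h1 := isBigO_one_of_continuousAt hpoly
      have hzN : ContinuousAt (fun z : ℂ => z ^ N) 0 := by fun_prop
      have h2 : (fun z : ℂ => z ^ N * ψ z) =O[𝓝[≠] (0 : ℂ)] (fun _ => (1 : ℝ)) := by
        simpa using (isBigO_one_of_continuousAt hzN).mul hψ
      rw [hB]; exact h1.add h2
    have h0 : F 0 = c 0 := by
      apply apply_zero_eq_of_expansion (hF.differentiableAt hball).continuousAt hBO
      filter_upwards [hmem] with z hz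
      exact hexp z hz.2 hz.1
    rcases n with _ | m
    · simpa [jetCoeff_zero] using h0
    · -- pass to `dslope F 0`
      have hdF : DifferentiableOn ℂ (dslope F 0) (ball 0 r) :=
        (Complex.differentiableOn_dslope hball).mpr hF
      have hexp' : ∀ z ∈ ball (0 : ℂ) r, z ≠ 0 →
          dslope F 0 z = (∑ m ∈ range N, c (m + 1) * z ^ m) + z ^ N * ψ z := by
        intro z hz hz0
        rw [dslope_of_ne _ hz0, slope_def_field, sub_zero, h0, hexp z hz hz0]
        field_simp
        simp [hB]
      rw [jetCoeff_succ']
      exact ih (dslope F 0) (fun m => c (m + 1)) hdF hexp' m (by omega)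

/-- Uniqueness, version with an expansion valid on the whole ball and `ψ` continuous at `0`.
[cite: MckeeSmyth2021, §12.1.1 (12.3) p.206] -/
theorem jetCoeff_unique' {r : ℝ} (hr : 0 < r) {F ψ : ℂ → ℂ} {N : ℕ} {c : ℕ → ℂ}
    (hF : DifferentiableOn ℂ F (ball 0 r)) (hψ : ContinuousAt ψ 0)
    (h : ∀ z ∈ ball (0 : ℂ) r, F z = (∑ n ∈ range N, c n * z ^ n) + z ^ N * ψ z) :
    ∀ n < N, jetCoeff F n = c n :=
  jetCoeff_unique hr (isBigO_one_of_continuousAt hψ) N F c hF (fun z hz _ => h z hz)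

/-! ### Linearity -/

/-- Additivity of Taylor coefficients. [cite: MckeeSmyth2021, §12.1.1 (12.3) p.206] -/
theorem jetCoeff_add {r : ℝ} (hr : 0 < r) {F G : ℂ → ℂ} (hF : DifferentiableOn ℂ F (ball 0 r))
    (hG : DifferentiableOn ℂ G (ball 0 r)) (n : ℕ) :
    jetCoeff (fun z => F z + G z) n = jetCoeff F n + jetCoeff G n := by
  have hψ : ContinuousAt (fun z => jetTail F (n + 1) z + jetTail G (n + 1) z) 0 :=
    (continuousAt_jetTail hr hF _).add (continuousAt_jetTail hr hG _)
  refine jetCoeff_unique' hr (F := fun z => F z + G z) (c := fun m => jetCoeff F m + jetCoeff G m)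
    (hF.add hG) hψ ?_ n (Nat.lt_add_one n)
  intro z _
  rw [jet_eq F (n + 1) z, jet_eq G (n + 1) z]
  simp only [add_mul, Finset.sum_add_distrib]
  ring

/-- Homogeneity of Taylor coefficients. [cite: MckeeSmyth2021, §12.1.1 (12.3) p.206] -/
theorem jetCoeff_const_mul {r : ℝ} (hr : 0 < r) {F : ℂ → ℂ} (hF : DifferentiableOn ℂ F (ball 0 r))
    (a : ℂ) (n : ℕ) : jetCoeff (fun z => a * F z) n = a * jetCoeff F n := by
  have hψ : ContinuousAt (fun z => a * jetTail F (n + 1) z) 0 :=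
    (continuousAt_const.mul (continuousAt_jetTail hr hF _))
  refine jetCoeff_unique' hr (F := fun z => a * F z) (c := fun m => a * jetCoeff F m)
    (hF.const_mul a) hψ ?_ n (Nat.lt_add_one n)
  intro z _
  rw [jet_eq F (n + 1) z, mul_add, Finset.mul_sum]
  have : ∀ m ∈ range (n + 1), a * (jetCoeff F m * z ^ m) = a * jetCoeff F m * z ^ m := by
    intro m _; ring
  rw [Finset.sum_congr rfl this]; ring

/-- Coefficients of a difference. [cite: MckeeSmyth2021, §12.1.1 (12.3) p.206] -/
theorem jetCoeff_sub {r : ℝ} (hr : 0 < r) {F G : ℂ → ℂ} (hF : DifferentiableOn ℂ F (ball 0 r))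
    (hG : DifferentiableOn ℂ G (ball 0 r)) (n : ℕ) :
    jetCoeff (fun z => F z - G z) n = jetCoeff F n - jetCoeff G n := by
  have hψ : ContinuousAt (fun z => jetTail F (n + 1) z - jetTail G (n + 1) z) 0 :=
    (continuousAt_jetTail hr hF _).sub (continuousAt_jetTail hr hG _)
  refine jetCoeff_unique' hr (F := fun z => F z - G z) (c := fun m => jetCoeff F m - jetCoeff G m)
    (hF.sub hG) hψ ?_ n (Nat.lt_add_one n)
  intro z _
  rw [jet_eq F (n + 1) z, jet_eq G (n + 1) z]
  simp only [sub_mul, Finset.sum_sub_distrib]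
  ring

/-- Coefficients of a constant function. [cite: MckeeSmyth2021, §12.1.1 (12.3) p.206] -/
theorem jetCoeff_const (a : ℂ) (n : ℕ) : jetCoeff (fun _ : ℂ => a) n = if n = 0 then a else 0 := by
  have hd : DifferentiableOn ℂ (fun _ : ℂ => a) (ball 0 1) := differentiableOn_const a
  have h := jetCoeff_unique' (N := n + 1) (c := fun m => if m = 0 then a else 0) one_pos hd
    (ψ := fun _ => 0) continuousAt_const ?_ n (Nat.lt_add_one n)
  · exact h
  · intro z _
    rw [Finset.sum_eq_single_of_mem 0 (Finset.mem_range.mpr (by omega))]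
    · simp
    · intro m _ hm; simp [hm]

end

end Literature.Analysis.Complex

end Part1

/-!
## Part 2 — port of `Summits/Ventures/DiscreteObjects/Mahler/TaylorJetProduct.lean` (11 declarations kept)

# Taylor jets at the origin: products, rotations and rotation averages (venture `DiscreteObjects`, target L)

Cell `pub-namedobj`, seat `pub-namedobj-mahler` (gen 8). Framing: lottery ticket; floor = certified
bounds/negative ranges.

Continuation of `TaylorJet.lean` (infrastructure for the in-tree proof of Smyth's theorem,
[McKee–Smyth, *Around the Unit Circle*, Thm 12.1]):

* `jetPoly F N` — the Taylor polynomial of order `< N`; `eval_eq_sum_range_add_pow_mul` splits the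
  evaluation of any complex polynomial at order `N`;
* `jetCoeff_mul` — the Cauchy product rule for Taylor coefficients of a product of two functions
  holomorphic on a disc; `jetCoeff_pow_mul` — multiplication by `z^k` shifts coefficients;
* `jetCoeff_comp_mul_left` — coefficients of `z ↦ F(ω z)` (`‖ω‖ = 1`) are `ωⁿ · jetCoeff F n`;
* `jetCoeff_rotAvg` — the rotation average `z ↦ k⁻¹ Σ_{j<k} F(ωʲ z)` over the `k`-th roots of unity keeps
  exactly the coefficients of index divisible by `k` ([McKee–Smyth, Prop. 12.7]).
-/

section Part2

namespace Literature.Analysis.Complex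

open Literature.Analysis.Complex.SchurAlgorithm

open _root_.Polynomial _root_.Metric _root_.Filter _root_.Topology _root_.Asymptotics _root_.Finset

noncomputable section

/-! ### Locality -/

/-- Taylor coefficients only depend on the function on the disc: if `F'` agrees with a function `F`
holomorphic on `ball 0 r` there, then their coefficients agree. [cite: MckeeSmyth2021, §12.1.1 (12.3)–(12.4) p.206] -/
theorem jetCoeff_congr {r : ℝ} (hr : 0 < r) {F F' : ℂ → ℂ} (hF : DifferentiableOn ℂ F (ball 0 r))
    (h : ∀ z ∈ ball (0 : ℂ) r, F' z = F z) (n : ℕ) : jetCoeff F' n = jetCoeff F n :=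
  jetCoeff_unique' hr (F := F') (hF.congr h) (continuousAt_jetTail hr hF (n + 1))
    (fun z hz => by rw [h z hz]; exact jet_eq F (n + 1) z) n (Nat.lt_add_one n)

/-! ### Products -/

/-- The Taylor polynomial of order `< N`. [cite: MckeeSmyth2021, §12.1.1 (12.3)–(12.4) p.206] -/
def jetPoly (F : ℂ → ℂ) (N : ℕ) : ℂ[X] := ∑ n ∈ range N, C (jetCoeff F n) * X ^ n

/-- Coefficients of the Taylor polynomial. [cite: MckeeSmyth2021, §12.1.1 (12.3)–(12.4) p.206] -/
theorem coeff_jetPoly (F : ℂ → ℂ) (N n : ℕ) :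
    (jetPoly F N).coeff n = if n < N then jetCoeff F n else 0 := by
  rw [jetPoly, finsetSum_coeff]
  simp only [coeff_C_mul_X_pow]
  split_ifs with h
  · rw [Finset.sum_eq_single_of_mem n (Finset.mem_range.mpr h)]
    · simp
    · intro m _ hm; simp [Ne.symm hm]
  · apply Finset.sum_eq_zero
    intro m hm
    have : n ≠ m := by intro e; subst e; exact h (Finset.mem_range.mp hm)
    simp [this]

/-- Evaluation of the Taylor polynomial. [cite: MckeeSmyth2021, §12.1.1 (12.3)–(12.4) p.206] -/
theorem eval_jetPoly (F : ℂ → ℂ) (N : ℕ) (z : ℂ) :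
    (jetPoly F N).eval z = ∑ n ∈ range N, jetCoeff F n * z ^ n := by
  simp [jetPoly, eval_finsetSum]

/-- Evaluation of a complex polynomial split at order `N`:
`R(z) = Σ_{n<N} R.coeff n zⁿ + z^N · (R /ₘ X^N)(z)`. [cite: MckeeSmyth2021, §12.1.1 (12.3)–(12.4) p.206] -/
theorem eval_eq_sum_range_add_pow_mul (R : ℂ[X]) (N : ℕ) (z : ℂ) :
    R.eval z = (∑ n ∈ range N, R.coeff n * z ^ n) + z ^ N * (R /ₘ X ^ N).eval z := by
  have hmonic : (X ^ N : ℂ[X]).Monic := monic_X_pow N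
  have hsplit : R %ₘ X ^ N + X ^ N * (R /ₘ X ^ N) = R := modByMonic_add_div R (X ^ N)
  have hdeg : (R %ₘ X ^ N).degree < N := by
    have := degree_modByMonic_lt R hmonic
    rwa [degree_X_pow] at this
  have hcoeff : ∀ n < N, (R %ₘ X ^ N).coeff n = R.coeff n := by
    intro n hn
    conv_rhs => rw [← hsplit]
    rw [coeff_add, coeff_X_pow_mul', if_neg (by omega), add_zero]
  have heval : (R %ₘ X ^ N).eval z = ∑ n ∈ range N, R.coeff n * z ^ n := by
    rcases Nat.eq_zero_or_pos N with hN | hN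
    · subst hN
      have : R %ₘ X ^ 0 = 0 := by
        rw [pow_zero]; exact modByMonic_one R
      rw [this]; simp
    · have hnat : (R %ₘ X ^ N).natDegree < N := by
        by_cases h0 : R %ₘ X ^ N = 0
        · rw [h0, natDegree_zero]; exact hN
        · exact (natDegree_lt_iff_degree_lt h0).mpr hdeg
      rw [eval_eq_sum_range' hnat]
      exact Finset.sum_congr rfl (fun n hn => by rw [hcoeff n (Finset.mem_range.mp hn)])
  conv_lhs => rw [← hsplit]
  rw [eval_add, eval_mul, eval_pow, eval_X, heval]

/-- **Product rule for Taylor coefficients** (Cauchy product). [cite: MckeeSmyth2021, §12.1.1 (12.3)–(12.4) p.206] -/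
theorem jetCoeff_mul {r : ℝ} (hr : 0 < r) {F G : ℂ → ℂ} (hF : DifferentiableOn ℂ F (ball 0 r))
    (hG : DifferentiableOn ℂ G (ball 0 r)) (n : ℕ) :
    jetCoeff (fun z => F z * G z) n =
      ∑ ij ∈ antidiagonal n, jetCoeff F ij.1 * jetCoeff G ij.2 := by
  set N := n + 1 with hN
  set R : ℂ[X] := jetPoly F N * jetPoly G N with hR
  have hRcoeff : ∀ m < N, R.coeff m = ∑ ij ∈ antidiagonal m, jetCoeff F ij.1 * jetCoeff G ij.2 := by
    intro m hm
    rw [hR, coeff_mul]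
    apply Finset.sum_congr rfl
    intro ij hij
    have h : ij.1 + ij.2 = m := by simpa using hij
    rw [coeff_jetPoly, coeff_jetPoly, if_pos (by omega), if_pos (by omega)]
  -- the remainder
  set ψ := jetTail F N
  set χ := jetTail G N
  set Θ : ℂ → ℂ := fun z => (R /ₘ X ^ N).eval z + (jetPoly F N).eval z * χ z +
    ψ z * (jetPoly G N).eval z + z ^ N * (ψ z * χ z) with hΘ
  have hΘc : ContinuousAt Θ 0 := by
    have h1 : ContinuousAt ψ 0 := continuousAt_jetTail hr hF N
    have h2 : ContinuousAt χ 0 := continuousAt_jetTail hr hG N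
    have h3 : ContinuousAt (fun z => (R /ₘ X ^ N).eval z) 0 := (Polynomial.continuous _).continuousAt
    have h4 : ContinuousAt (fun z => (jetPoly F N).eval z) 0 := (Polynomial.continuous _).continuousAt
    have h5 : ContinuousAt (fun z => (jetPoly G N).eval z) 0 := (Polynomial.continuous _).continuousAt
    simp only [hΘ]
    fun_prop
  have hexp : ∀ z ∈ ball (0 : ℂ) r, F z * G z = (∑ m ∈ range N, R.coeff m * z ^ m) + z ^ N * Θ z := by
    intro z _
    have eF := jet_eq F N z
    have eG := jet_eq G N z
    rw [← eval_jetPoly] at eF eG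
    have eR : (jetPoly F N).eval z * (jetPoly G N).eval z = R.eval z := by rw [hR, eval_mul]
    rw [eF, eG]
    have := eval_eq_sum_range_add_pow_mul R N z
    simp only [hΘ]
    linear_combination eR + this
  have h := jetCoeff_unique' hr (F := fun z => F z * G z) (hF.mul hG) hΘc hexp n (by omega)
  rw [h, hRcoeff n (by omega)]

/-- Product with a fixed power of `z`: shifts the coefficients. [cite: MckeeSmyth2021, §12.1.1 (12.3)–(12.4) p.206] -/
theorem jetCoeff_pow_mul {r : ℝ} (hr : 0 < r) {F : ℂ → ℂ} (hF : DifferentiableOn ℂ F (ball 0 r))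
    (k n : ℕ) : jetCoeff (fun z => z ^ k * F z) (n + k) = jetCoeff F n := by
  have hψ : ContinuousAt (jetTail F (n + 1)) 0 := continuousAt_jetTail hr hF _
  have hd : DifferentiableOn ℂ (fun z => z ^ k * F z) (ball 0 r) := by
    exact (differentiableOn_id.pow k).mul hF
  refine jetCoeff_unique' (N := n + k + 1) (c := fun m => if k ≤ m then jetCoeff F (m - k) else 0)
    hr hd hψ ?_ (n + k) (by omega) |>.trans (by simp)
  intro z _
  rw [jet_eq F (n + 1) z, mul_add, Finset.mul_sum]
  have hsplit : ∑ m ∈ range (n + k + 1), (if k ≤ m then jetCoeff F (m - k) else 0) * z ^ m =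
      ∑ m ∈ range (n + 1), z ^ k * (jetCoeff F m * z ^ m) := by
    have : range (n + k + 1) = range k ∪ Finset.image (fun m => m + k) (range (n + 1)) := by
      ext m
      simp only [Finset.mem_union, Finset.mem_range, Finset.mem_image]
      constructor
      · intro hm
        by_cases hmk : m < k
        · exact Or.inl hmk
        · exact Or.inr ⟨m - k, by omega, by omega⟩
      · rintro (hm | ⟨a, ha, rfl⟩) <;> omega
    rw [this, Finset.sum_union]
    · rw [Finset.sum_eq_zero (fun m hm => by
        rw [if_neg (by have := Finset.mem_range.mp hm; omega), zero_mul])]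
      rw [zero_add, Finset.sum_image (fun a _ b _ h => by omega)]
      apply Finset.sum_congr rfl
      intro m _
      rw [if_pos (by omega), Nat.add_sub_cancel, pow_add]; ring
    · rw [Finset.disjoint_left]
      intro m hm hm'
      simp only [Finset.mem_range, Finset.mem_image] at hm hm'
      obtain ⟨a, _, ha⟩ := hm'
      omega
  rw [hsplit]; ring

/-! ### Rotations and rotation averages -/

/-- `z ↦ F(ω z)` is holomorphic on the disc when `‖ω‖ = 1`. [cite: MckeeSmyth2021, §12.1.1 (12.3)–(12.4) p.206] -/
theorem differentiableOn_comp_mul_left {F : ℂ → ℂ} {ω : ℂ} (hω : ‖ω‖ = 1) {r : ℝ}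
    (hF : DifferentiableOn ℂ F (ball 0 r)) : DifferentiableOn ℂ (fun z => F (ω * z)) (ball 0 r) := by
  have hmul : DifferentiableOn ℂ (fun z : ℂ => ω * z) (ball 0 r) := by fun_prop
  refine hF.comp hmul ?_
  intro z hz
  simp only [mem_ball, dist_zero_right] at hz ⊢
  rw [norm_mul, hω, one_mul]; exact hz

/-- Coefficients of `z ↦ F(ω z)` for `‖ω‖ = 1`: `ωⁿ · jetCoeff F n`.
[cite: MckeeSmyth2021, §12.1.1 (12.3)–(12.4) p.206] -/
theorem jetCoeff_comp_mul_left {r : ℝ} (hr : 0 < r) {F : ℂ → ℂ} (hF : DifferentiableOn ℂ F (ball 0 r))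
    {ω : ℂ} (hω : ‖ω‖ = 1) (n : ℕ) : jetCoeff (fun z => F (ω * z)) n = ω ^ n * jetCoeff F n := by
  have hψ : ContinuousAt (fun z => ω ^ (n + 1) * jetTail F (n + 1) (ω * z)) 0 := by
    have h1 : ContinuousAt (jetTail F (n + 1)) (ω * 0) := by
      rw [mul_zero]; exact continuousAt_jetTail hr hF _
    have h2 : ContinuousAt (fun z : ℂ => ω * z) 0 := by fun_prop
    exact continuousAt_const.mul (ContinuousAt.comp (g := jetTail F (n + 1)) h1 h2)
  refine jetCoeff_unique' (N := n + 1) (c := fun m => ω ^ m * jetCoeff F m) hr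
    (differentiableOn_comp_mul_left hω hF) hψ ?_ n (Nat.lt_add_one n)
  intro z _
  rw [jet_eq F (n + 1) (ω * z)]
  simp only [mul_pow]
  have : ∀ m ∈ range (n + 1), jetCoeff F m * (ω ^ m * z ^ m) = ω ^ m * jetCoeff F m * z ^ m := by
    intro m _; ring
  rw [Finset.sum_congr rfl this]; ring

/-- Character sums over the `k`-th roots of unity. [cite: MckeeSmyth2021, §12.1.1 (12.3)–(12.4) p.206] -/
theorem sum_pow_mul_eq {k : ℕ} {ω : ℂ} (hω : IsPrimitiveRoot ω k) (n : ℕ) :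
    ∑ j ∈ range k, (ω ^ j) ^ n = if k ∣ n then (k : ℂ) else 0 := by
  have h : ∀ j ∈ range k, (ω ^ j) ^ n = (ω ^ n) ^ j := by
    intro j _; rw [← pow_mul, ← pow_mul, mul_comm]
  rw [Finset.sum_congr rfl h]
  split_ifs with hdvd
  · have : ω ^ n = 1 := (hω.pow_eq_one_iff_dvd n).mpr hdvd
    simp [this]
  · have hne : ω ^ n ≠ 1 := fun e => hdvd ((hω.pow_eq_one_iff_dvd n).mp e)
    have hk1 : (ω ^ n) ^ k = 1 := by rw [← pow_mul, mul_comm, pow_mul, hω.pow_eq_one, one_pow]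
    rw [geom_sum_eq hne, hk1, sub_self, zero_div]

/-- **Rotation average.** For `ω` a primitive `k`-th root of unity the function
`z ↦ k⁻¹ Σ_{j<k} F(ωʲ z)` has Taylor coefficients `jetCoeff F n` for `k ∣ n` and `0` otherwise.
[cite: MckeeSmyth2021, §12.1.1 (12.3)–(12.4) p.206] -/
theorem jetCoeff_rotAvg {r : ℝ} (hr : 0 < r) {F : ℂ → ℂ} (hF : DifferentiableOn ℂ F (ball 0 r))
    {k : ℕ} (hk : 1 ≤ k) {ω : ℂ} (hω : IsPrimitiveRoot ω k) (n : ℕ) :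
    jetCoeff (fun z => (k : ℂ)⁻¹ * ∑ j ∈ range k, F (ω ^ j * z)) n =
      if k ∣ n then jetCoeff F n else 0 := by
  have hω1 : ‖ω‖ = 1 := hω.norm'_eq_one (by omega)
  have hωj : ∀ j : ℕ, ‖ω ^ j‖ = 1 := fun j => by rw [norm_pow, hω1, one_pow]
  have hdj : ∀ j : ℕ, DifferentiableOn ℂ (fun z => F (ω ^ j * z)) (ball 0 r) :=
    fun j => differentiableOn_comp_mul_left (hωj j) hF
  -- coefficients of the sum, by induction over the number of summands via linearity
  have hsum : ∀ (s : Finset ℕ), jetCoeff (fun z => ∑ j ∈ s, F (ω ^ j * z)) n =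
      ∑ j ∈ s, (ω ^ j) ^ n * jetCoeff F n := by
    intro s
    induction s using Finset.induction_on with
    | empty => simp [jetCoeff_const]
    | insert a s ha ih =>
      have hds : DifferentiableOn ℂ (fun z => ∑ j ∈ s, F (ω ^ j * z)) (ball 0 r) :=
        DifferentiableOn.fun_sum (u := s) (fun j _ => hdj j)
      rw [Finset.sum_insert ha]
      have e : (fun z => ∑ j ∈ insert a s, F (ω ^ j * z)) =
          fun z => F (ω ^ a * z) + ∑ j ∈ s, F (ω ^ j * z) := by
        funext z; rw [Finset.sum_insert ha]
      rw [e, jetCoeff_add hr (hdj a) hds, ih, jetCoeff_comp_mul_left hr hF (hωj a)]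
  have hdS : DifferentiableOn ℂ (fun z => ∑ j ∈ range k, F (ω ^ j * z)) (ball 0 r) :=
    DifferentiableOn.fun_sum (u := range k) (fun j _ => hdj j)
  rw [jetCoeff_const_mul hr hdS, hsum, ← Finset.sum_mul, sum_pow_mul_eq hω n]
  have hk0 : (k : ℂ) ≠ 0 := by exact_mod_cast (show k ≠ 0 by omega)
  split_ifs
  · field_simp
  · simp

end

end Literature.Analysis.Complex

end Part2

/-!
## Part 3 — port of `Summits/Ventures/DiscreteObjects/Mahler/SchwarzPickCoeff.lean`

# Schwarz–Pick coefficient bound and rotation averaging (venture `DiscreteObjects`, target L)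

Cell `pub-namedobj`, seat `pub-namedobj-mahler` (gen 7). Framing: lottery ticket; floor = certified
bounds/negative ranges.

Analytic lemmas for the nonreciprocal Mahler-measure bound (`NonreciprocalMeasureBound.lean`):

* the two Blaschke-factor bounds `‖w - a‖ ≤ ‖1 - ā w‖` (`‖a‖ ≤ 1`) and `‖1 - ā w‖ ≤ ‖w - a‖`
  (`‖a‖ ≥ 1`) for `‖w‖ ≤ 1`, from the Möbius identity of `Literature.Analysis.Complex.RiemannMapping`
  (`Complex.norm_sq_one_sub_conj_mul_sub`);
* `norm_le_one_of_eq_pow_mul` — if `Θ` maps the unit disc into the closed unit disc and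
  `Θ z = z ^ k * Ψ z` with `Ψ` holomorphic (`k ≥ 1`), then `‖Ψ 0‖ ≤ 1` (Mathlib's higher-order
  Schwarz lemma `Complex.dist_le_mul_div_pow_of_mapsTo_ball_of_isLittleO`);
* `norm_coeff_le_one_sub_norm_sq` — the Schwarz–Pick bound on a `k`-th coefficient: if `Φ` maps the
  unit disc into the closed unit disc and `Φ z = c + z ^ k * ψ z` (`k ≥ 1`, `ψ` holomorphic), then
  `‖ψ 0‖ ≤ 1 - ‖c‖²` ([McKee–Smyth, *Around the Unit Circle*, Prop. 12.11(b)]);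
* `exists_flat_of_rotation_invariant` — a holomorphic `Φ` on the disc with `Φ (ω z) = Φ z` for a
  primitive `k`-th root of unity `ω` is `Φ 0 + z ^ k * ψ z` with `ψ` holomorphic (removable
  singularities, `Complex.differentiableOn_dslope`).
-/

section Part3

namespace Literature.Analysis.Complex

open Literature.Analysis.Complex.SchurAlgorithm

open _root_.Complex _root_.Metric _root_.Set _root_.Filter _root_.Topology
open scoped ComplexConjugate

/-! ### Möbius / Blaschke factor inequalities -/

/-- Blaschke factor bound (zero inside): for `‖a‖ ≤ 1` and `‖w‖ ≤ 1`, `‖w - a‖ ≤ ‖1 - conj a * w‖`.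
[cite: MckeeSmyth2021, Proposition 12.11 (b) (case k = 1) p.207] -/
theorem norm_sub_le_norm_one_sub_conj_mul {a w : ℂ} (ha : ‖a‖ ≤ 1) (hw : ‖w‖ ≤ 1) :
    ‖w - a‖ ≤ ‖1 - conj a * w‖ := by
  have h := Complex.norm_sq_one_sub_conj_mul_sub a w
  have h1 : 0 ≤ (1 - ‖a‖ ^ 2) * (1 - ‖w‖ ^ 2) := by
    apply mul_nonneg <;> nlinarith [norm_nonneg a, norm_nonneg w]
  have h2 : ‖w - a‖ ^ 2 ≤ ‖1 - conj a * w‖ ^ 2 := by linarith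
  exact (pow_le_pow_iff_left₀ (norm_nonneg _) (norm_nonneg _) two_ne_zero).mp h2

/-- Blaschke factor bound (zero outside): for `1 ≤ ‖a‖` and `‖w‖ ≤ 1`, `‖1 - conj a * w‖ ≤ ‖w - a‖`.
[cite: MckeeSmyth2021, Proposition 12.11 (b) (case k = 1) p.207] -/
theorem norm_one_sub_conj_mul_le_norm_sub {a w : ℂ} (ha : 1 ≤ ‖a‖) (hw : ‖w‖ ≤ 1) :
    ‖1 - conj a * w‖ ≤ ‖w - a‖ := by
  have h := Complex.norm_sq_one_sub_conj_mul_sub a w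
  have h1 : (1 - ‖a‖ ^ 2) * (1 - ‖w‖ ^ 2) ≤ 0 := by
    apply mul_nonpos_of_nonpos_of_nonneg <;> nlinarith [norm_nonneg a, norm_nonneg w]
  have h2 : ‖1 - conj a * w‖ ^ 2 ≤ ‖w - a‖ ^ 2 := by linarith
  exact (pow_le_pow_iff_left₀ (norm_nonneg _) (norm_nonneg _) two_ne_zero).mp h2

/-- The Möbius map `w ↦ (w - a)/(1 - conj a * w)` (`‖a‖ < 1`) sends the closed unit disc into itself.
[cite: MckeeSmyth2021, Proposition 12.11 (b) (case k = 1) p.207] -/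
theorem norm_moebius_le_one {a w : ℂ} (ha : ‖a‖ < 1) (hw : ‖w‖ ≤ 1) :
    ‖(w - a) / (1 - conj a * w)‖ ≤ 1 := by
  rw [norm_div]
  exact div_le_one_of_le₀ (norm_sub_le_norm_one_sub_conj_mul ha.le hw) (norm_nonneg _)

/-! ### Schwarz-type bounds -/

/-- **Order-`k` Schwarz lemma at the origin.** If `Θ` maps the open unit disc into the closed unit
disc and `Θ z = z ^ k * Ψ z` there, with `Ψ` holomorphic on the disc and `k ≥ 1`, then `‖Ψ 0‖ ≤ 1`.
[cite: MckeeSmyth2021, Proposition 12.11 (b) (case k = 1) p.207] -/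
theorem norm_le_one_of_eq_pow_mul {Θ Ψ : ℂ → ℂ} {k : ℕ} (hk : 1 ≤ k)
    (hΨ : DifferentiableOn ℂ Ψ (ball 0 1)) (hbd : ∀ z ∈ ball (0 : ℂ) 1, ‖Θ z‖ ≤ 1)
    (hrep : ∀ z ∈ ball (0 : ℂ) 1, Θ z = z ^ k * Ψ z) : ‖Ψ 0‖ ≤ 1 := by
  have hball : ball (0 : ℂ) 1 ∈ 𝓝 (0 : ℂ) := ball_mem_nhds _ one_pos
  have hΘd : DifferentiableOn ℂ Θ (ball 0 1) := by
    have h1 : DifferentiableOn ℂ (fun z : ℂ => z ^ k * Ψ z) (ball 0 1) :=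
      (differentiableOn_id.pow k).mul hΨ
    exact h1.congr hrep
  have hΘ0 : Θ 0 = 0 := by
    rw [hrep 0 (mem_ball_self one_pos)]; simp [zero_pow (by omega : k ≠ 0)]
  have hmaps : MapsTo Θ (ball (0 : ℂ) 1) (closedBall (Θ 0) 1) := by
    intro z hz
    rw [hΘ0, mem_closedBall, dist_zero_right]
    exact hbd z hz
  -- `Θ z - Θ 0 = o(‖z‖ ^ (k-1))` at `0`
  have hcontΨ : ContinuousAt Ψ 0 := (hΨ.differentiableAt hball).continuousAt
  have hlit : (fun z => Θ z - Θ 0) =o[𝓝 (0 : ℂ)] fun w => ‖w - 0‖ ^ (k - 1) := by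
    have hev : (fun z => Θ z - Θ 0) =ᶠ[𝓝 (0 : ℂ)] fun z => z ^ (k - 1) * (z * Ψ z) := by
      filter_upwards [hball] with z hz
      rw [hΘ0, sub_zero, hrep z hz, ← mul_assoc, ← pow_succ, Nat.sub_add_cancel hk]
    refine Asymptotics.IsLittleO.congr' ?_ hev.symm EventuallyEq.rfl
    have h1 : (fun z : ℂ => z ^ (k - 1)) =O[𝓝 (0 : ℂ)] fun w => ‖w - 0‖ ^ (k - 1) := by
      apply Asymptotics.IsBigO.of_bound 1
      filter_upwards with z
      simp
    have h2 : (fun z : ℂ => z * Ψ z) =o[𝓝 (0 : ℂ)] fun _ => (1 : ℝ) := by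
      rw [Asymptotics.isLittleO_one_iff]
      have : Tendsto (fun z : ℂ => z * Ψ z) (𝓝 0) (𝓝 (0 * Ψ 0)) :=
        (continuous_id.tendsto 0).mul hcontΨ
      simpa using this
    simpa using h1.mul_isLittleO h2
  -- the higher-order Schwarz lemma
  have hS : ∀ z ∈ ball (0 : ℂ) 1, ‖z‖ ^ k * ‖Ψ z‖ ≤ ‖z‖ ^ k := by
    intro z hz
    have h := Complex.dist_le_mul_div_pow_of_mapsTo_ball_of_isLittleO hΘd hmaps hlit hz
    rw [Nat.sub_add_cancel hk, hΘ0, dist_zero_right, dist_zero_right, div_one, one_mul,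
      hrep z hz, norm_mul, norm_pow] at h
    exact h
  -- hence `‖Ψ z‖ ≤ 1` on the punctured disc, and at `0` by continuity
  have hpunct : ∀ᶠ z in 𝓝[≠] (0 : ℂ), Ψ z ∈ closedBall (0 : ℂ) 1 := by
    have hmem : {(0 : ℂ)}ᶜ ∩ ball (0 : ℂ) 1 ∈ 𝓝[≠] (0 : ℂ) := inter_mem_nhdsWithin _ hball
    filter_upwards [hmem] with z hz
    obtain ⟨hz0, hz1⟩ := hz
    have hz0' : z ≠ 0 := hz0
    have hpos : 0 < ‖z‖ ^ k := pow_pos (norm_pos_iff.mpr hz0') k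
    rw [mem_closedBall, dist_zero_right]
    have := hS z hz1
    by_contra hgt
    push Not at hgt
    have : ‖z‖ ^ k * 1 < ‖z‖ ^ k * ‖Ψ z‖ := mul_lt_mul_of_pos_left hgt hpos
    linarith
  have htend : Tendsto Ψ (𝓝[≠] (0 : ℂ)) (𝓝 (Ψ 0)) :=
    hcontΨ.tendsto.mono_left nhdsWithin_le_nhds
  have hmem0 : Ψ 0 ∈ closedBall (0 : ℂ) 1 := isClosed_closedBall.mem_of_tendsto htend hpunct
  simpa using hmem0

/-- **Schwarz–Pick bound on a `k`-th Taylor coefficient** ([McKee–Smyth, *Around the Unit Circle*,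
Prop. 12.11(b)]).  If `Φ` maps the open unit disc into the closed unit disc and
`Φ z = c + z ^ k * ψ z` there (`k ≥ 1`, `ψ` holomorphic on the disc), then `‖ψ 0‖ ≤ 1 - ‖c‖ ^ 2`.
Proof: for `0 < t < 1` compose `t • Φ` with the disc automorphism moving `t c` to `0` and apply the
order-`k` Schwarz lemma; then let `t → 1`. [cite: MckeeSmyth2021, Proposition 12.11 (b) (case k = 1) p.207] -/
theorem norm_coeff_le_one_sub_norm_sq {Φ ψ : ℂ → ℂ} {c : ℂ} {k : ℕ} (hk : 1 ≤ k)
    (hψ : DifferentiableOn ℂ ψ (ball 0 1)) (hbd : ∀ z ∈ ball (0 : ℂ) 1, ‖Φ z‖ ≤ 1)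
    (hrep : ∀ z ∈ ball (0 : ℂ) 1, Φ z = c + z ^ k * ψ z) : ‖ψ 0‖ ≤ 1 - ‖c‖ ^ 2 := by
  have hball : ball (0 : ℂ) 1 ∈ 𝓝 (0 : ℂ) := ball_mem_nhds _ one_pos
  have hΦd : DifferentiableOn ℂ Φ (ball 0 1) := by
    have h1 : DifferentiableOn ℂ (fun z : ℂ => c + z ^ k * ψ z) (ball 0 1) :=
      ((differentiableOn_id.pow k).mul hψ).const_add c
    exact h1.congr hrep
  have hc : ‖c‖ ≤ 1 := by
    have h := hbd 0 (mem_ball_self one_pos)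
    rw [hrep 0 (mem_ball_self one_pos)] at h
    simpa [zero_pow (by omega : k ≠ 0)] using h
  -- the bound `t ‖ψ 0‖ ≤ 1 - t² ‖c‖²` for every `t ∈ (0,1)`
  have key : ∀ t : ℝ, 0 < t → t < 1 → t * ‖ψ 0‖ ≤ 1 - t ^ 2 * ‖c‖ ^ 2 := by
    intro t ht0 ht1
    set ct : ℂ := (t : ℂ) * c with hct
    have hct_norm : ‖ct‖ = t * ‖c‖ := by
      rw [hct, norm_mul, Complex.norm_real, Real.norm_of_nonneg ht0.le]
    have hct1 : ‖ct‖ < 1 := by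
      rw [hct_norm]; nlinarith [norm_nonneg c]
    -- `t Φ` maps the disc into the closed disc of radius `t`
    have htΦ : ∀ z ∈ ball (0 : ℂ) 1, ‖(t : ℂ) * Φ z‖ ≤ 1 := by
      intro z hz
      rw [norm_mul, Complex.norm_real, Real.norm_of_nonneg ht0.le]
      nlinarith [hbd z hz, norm_nonneg (Φ z)]
    have hden : ∀ z ∈ ball (0 : ℂ) 1, 1 - conj ct * ((t : ℂ) * Φ z) ≠ 0 := fun z hz =>
      Complex.one_sub_conj_mul_ne_zero hct1 (htΦ z hz)
    -- the composed map `Θ = μ ∘ (t Φ)` and its quotient `Ψ = Θ / z^k`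
    set Θ : ℂ → ℂ := fun z => ((t : ℂ) * Φ z - ct) / (1 - conj ct * ((t : ℂ) * Φ z)) with hΘ
    set Ψ : ℂ → ℂ := fun z => (t : ℂ) * ψ z / (1 - conj ct * ((t : ℂ) * Φ z)) with hΨ
    have hΨd : DifferentiableOn ℂ Ψ (ball 0 1) := by
      apply DifferentiableOn.div
      · exact (differentiableOn_const _).mul hψ
      · exact (differentiableOn_const _).sub
          ((differentiableOn_const _).mul ((differentiableOn_const _).mul hΦd))
      · exact hden
    have hΘbd : ∀ z ∈ ball (0 : ℂ) 1, ‖Θ z‖ ≤ 1 := fun z hz =>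
      norm_moebius_le_one hct1 (htΦ z hz)
    have hΘrep : ∀ z ∈ ball (0 : ℂ) 1, Θ z = z ^ k * Ψ z := by
      intro z hz
      simp only [hΘ, hΨ]
      rw [mul_div_assoc']
      congr 1
      rw [hrep z hz, hct]
      ring
    have h1 : ‖Ψ 0‖ ≤ 1 := norm_le_one_of_eq_pow_mul hk hΨd hΘbd hΘrep
    -- evaluate `Ψ 0 = t ψ 0 / (1 - t² ‖c‖²)`
    have hΦ0 : Φ 0 = c := by
      rw [hrep 0 (mem_ball_self one_pos)]; simp [zero_pow (by omega : k ≠ 0)]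
    have hden0 : (1 - conj ct * ((t : ℂ) * Φ 0)) = ((1 - t ^ 2 * ‖c‖ ^ 2 : ℝ) : ℂ) := by
      rw [hΦ0, hct, map_mul, Complex.conj_ofReal]
      have : conj c * c = ((‖c‖ : ℂ)) ^ 2 := Complex.conj_mul' c
      push_cast
      linear_combination (-(t : ℂ) ^ 2) * this
    have hpos : 0 < 1 - t ^ 2 * ‖c‖ ^ 2 := by
      have : t ^ 2 * ‖c‖ ^ 2 < 1 := by
        calc t ^ 2 * ‖c‖ ^ 2 ≤ t ^ 2 * 1 := by
              apply mul_le_mul_of_nonneg_left _ (sq_nonneg t); nlinarith [norm_nonneg c]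
          _ < 1 := by nlinarith
      linarith
    have hΨ0 : ‖Ψ 0‖ = t * ‖ψ 0‖ / (1 - t ^ 2 * ‖c‖ ^ 2) := by
      simp only [hΨ]
      rw [hden0, norm_div, norm_mul, Complex.norm_real, Complex.norm_real,
        Real.norm_of_nonneg ht0.le, Real.norm_of_nonneg hpos.le]
    rw [hΨ0, div_le_one hpos] at h1
    exact h1
  -- let `t → 1`
  have hcont : ContinuousWithinAt (fun t : ℝ => t * ‖ψ 0‖ + t ^ 2 * ‖c‖ ^ 2) (Set.Iio 1) 1 := by
    apply Continuous.continuousWithinAt; fun_prop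
  have hle : ∀ᶠ t in 𝓝[<] (1 : ℝ), t * ‖ψ 0‖ + t ^ 2 * ‖c‖ ^ 2 ≤ 1 := by
    have hmem : Set.Ioo (0 : ℝ) 1 ∈ 𝓝[<] (1 : ℝ) := Ioo_mem_nhdsLT one_pos
    filter_upwards [hmem] with t ht
    have := key t ht.1 ht.2
    linarith
  have hlim : Tendsto (fun t : ℝ => t * ‖ψ 0‖ + t ^ 2 * ‖c‖ ^ 2) (𝓝[<] (1 : ℝ))
      (𝓝 (1 * ‖ψ 0‖ + 1 ^ 2 * ‖c‖ ^ 2)) := hcont.tendsto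
  have := le_of_tendsto hlim hle
  linarith

/-! ### Rotation averaging -/

/-- A function on the punctured disc that is continuous at `0` and vanishes off `0` vanishes at `0`.
[cite: MckeeSmyth2021, Proposition 12.11 (b) (case k = 1) p.207] -/
theorem eq_zero_of_eq_zero_off_zero {G : ℂ → ℂ} (hG : ContinuousAt G 0)
    (h : ∀ z ∈ ball (0 : ℂ) 1, z ≠ 0 → G z = 0) : G 0 = 0 := by
  have hball : ball (0 : ℂ) 1 ∈ 𝓝 (0 : ℂ) := ball_mem_nhds _ one_pos
  have hmem : {(0 : ℂ)}ᶜ ∩ ball (0 : ℂ) 1 ∈ 𝓝[≠] (0 : ℂ) := inter_mem_nhdsWithin _ hball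
  have hev : G =ᶠ[𝓝[≠] (0 : ℂ)] fun _ => 0 := by
    filter_upwards [hmem] with z hz
    exact h z hz.2 hz.1
  have h1 : Tendsto G (𝓝[≠] (0 : ℂ)) (𝓝 (G 0)) := hG.tendsto.mono_left nhdsWithin_le_nhds
  have h2 : Tendsto G (𝓝[≠] (0 : ℂ)) (𝓝 0) := (tendsto_const_nhds).congr' hev.symm
  exact tendsto_nhds_unique h1 h2

/-- **Rotation-invariant holomorphic functions are flat to order `k`.**  If `Φ` is holomorphic on the
unit disc and `Φ (ω z) = Φ z` for a primitive `k`-th root of unity `ω` (`k ≥ 1`), then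
`Φ z = Φ 0 + z ^ k * ψ z` with `ψ` holomorphic on the disc (its Taylor coefficients of index
`1, …, k-1` vanish).  Proof by `k` removable singularities (`dslope`).
[cite: MckeeSmyth2021, Proposition 12.11 (b) (case k = 1) p.207] -/
theorem exists_flat_of_rotation_invariant {Φ : ℂ → ℂ} {ω : ℂ} {k : ℕ} (hω : IsPrimitiveRoot ω k)
    (hk : 1 ≤ k) (hΦ : DifferentiableOn ℂ Φ (ball 0 1))
    (hinv : ∀ z ∈ ball (0 : ℂ) 1, Φ (ω * z) = Φ z) :
    ∃ ψ : ℂ → ℂ, DifferentiableOn ℂ ψ (ball 0 1) ∧ ∀ z ∈ ball (0 : ℂ) 1, Φ z = Φ 0 + z ^ k * ψ z := by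
  have hball : ball (0 : ℂ) 1 ∈ 𝓝 (0 : ℂ) := ball_mem_nhds _ one_pos
  have hω1 : ‖ω‖ = 1 := hω.norm'_eq_one (by omega)
  have hωball : ∀ z ∈ ball (0 : ℂ) 1, ω * z ∈ ball (0 : ℂ) 1 := by
    intro z hz
    rw [mem_ball_zero_iff] at hz ⊢
    rw [norm_mul, hω1, one_mul]; exact hz
  -- induction on the order of flatness `j ≤ k`
  suffices H : ∀ j : ℕ, j ≤ k → ∃ ψ : ℂ → ℂ, DifferentiableOn ℂ ψ (ball 0 1) ∧
      ∀ z ∈ ball (0 : ℂ) 1, Φ z = Φ 0 + z ^ j * ψ z from H k le_rfl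
  intro j
  induction j with
  | zero =>
    intro _
    exact ⟨fun z => Φ z - Φ 0, hΦ.sub_const _, fun z _ => by ring⟩
  | succ j ih =>
    intro hjk
    obtain ⟨ψ, hψd, hψ⟩ := ih (by omega)
    -- the current coefficient `ψ 0` vanishes
    have hψ0 : ψ 0 = 0 := by
      rcases Nat.eq_zero_or_pos j with hj0 | hjpos
      · subst hj0
        have := hψ 0 (mem_ball_self one_pos)
        simpa using this
      · -- rotation invariance: `ω^j ψ (ω z) = ψ z` off `0`, hence at `0`
        have hωj : ω ^ j ≠ 1 := hω.pow_ne_one_of_pos_of_lt hjpos.ne' (by omega)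
        set G : ℂ → ℂ := fun z => ω ^ j * ψ (ω * z) - ψ z with hG
        have hGc : ContinuousAt G 0 := by
          have hψc : ContinuousAt ψ 0 := (hψd.differentiableAt hball).continuousAt
          have hψc' : ContinuousAt (fun z => ψ (ω * z)) 0 := by
            have h1 : ContinuousAt ψ (ω * 0) := by rw [mul_zero]; exact hψc
            exact ContinuousAt.comp (f := fun z : ℂ => ω * z) h1 (by fun_prop)
          exact (hψc'.const_mul _).sub hψc
        have hGoff : ∀ z ∈ ball (0 : ℂ) 1, z ≠ 0 → G z = 0 := by
          intro z hz hz0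
          have h1 := hψ z hz
          have h2 := hψ (ω * z) (hωball z hz)
          rw [hinv z hz, h1, mul_pow] at h2
          -- `z^j * ψ z = ω^j * z^j * ψ (ω z)`
          have h3 : z ^ j * (ω ^ j * ψ (ω * z) - ψ z) = 0 := by linear_combination -h2
          have hzj : z ^ j ≠ 0 := pow_ne_zero j hz0
          simpa [hG] using (mul_eq_zero.mp h3).resolve_left hzj
        have hG0 := eq_zero_of_eq_zero_off_zero hGc hGoff
        simp only [hG, mul_zero] at hG0
        have : (ω ^ j - 1) * ψ 0 = 0 := by linear_combination hG0
        exact (mul_eq_zero.mp this).resolve_left (sub_ne_zero.mpr hωj)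
    -- peel off one more factor of `z`
    refine ⟨dslope ψ 0, (Complex.differentiableOn_dslope hball).mpr hψd, fun z hz => ?_⟩
    have hds : (z - 0) • dslope ψ 0 z = ψ z - ψ 0 := sub_smul_dslope ψ 0 z
    rw [sub_zero, hψ0, sub_zero, smul_eq_mul] at hds
    rw [hψ z hz, ← hds]
    ring

end Literature.Analysis.Complex

end Part3

/-!
## Part 4 — port of `Summits/Ventures/DiscreteObjects/Mahler/NonreciprocalMeasureBound.lean` (5 declarations kept)

The rotation averages `z ↦ k⁻¹ Σ_{j<k} h(ω^j z)` over the `k`-th roots of unity (McKee–Smyth Proposition 12.7: `f_k(z^k) = k⁻¹ Σ f(ω^j z)`): they preserve holomorphy on discs and the bound `‖h‖ ≤ 1`, are rotation invariant, and have the same value at `0`.  (The remaining declarations of this source module — the bound `M(P) ≥ (1 + √17)/4` — are ported in `Literature/NumberTheory/MahlerMeasure/SmythNonreciprocalTheorem.lean`.)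
-/

section Part4

namespace Literature.Analysis.Complex

open Literature.Analysis.Complex.SchurAlgorithm

open _root_.Polynomial _root_.Complex _root_.Metric _root_.Set _root_.Filter _root_.Topology
open scoped ComplexConjugate

/-! ### Averaging over the `k`-th roots of unity -/

/-- Rotations by a unimodular `ω` preserve discs around `0`. [cite: MckeeSmyth2021, Proposition 12.7 p.207] -/
theorem pow_mul_mem_ball {ω : ℂ} (hω : ‖ω‖ = 1) (j : ℕ) {r : ℝ} {z : ℂ} (hz : z ∈ ball (0 : ℂ) r) :
    ω ^ j * z ∈ ball (0 : ℂ) r := by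
  rw [mem_ball_zero_iff] at hz ⊢
  rw [norm_mul, norm_pow, hω, one_pow, one_mul]; exact hz

/-- The rotation average `z ↦ k⁻¹ Σ_{j<k} h(ω^j z)` of a function holomorphic on a disc around `0` is
holomorphic there. [cite: MckeeSmyth2021, Proposition 12.7 p.207] -/
theorem differentiableOn_rotAvg (k : ℕ) {ω : ℂ} (hω : ‖ω‖ = 1) {h : ℂ → ℂ} {r : ℝ}
    (hd : DifferentiableOn ℂ h (ball 0 r)) :
    DifferentiableOn ℂ (fun z => (k : ℂ)⁻¹ * ∑ j ∈ Finset.range k, h (ω ^ j * z)) (ball 0 r) := by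
  apply DifferentiableOn.const_mul
  apply DifferentiableOn.fun_sum
  intro j _
  exact hd.comp ((differentiableOn_const _).mul differentiableOn_id) fun z hz => pow_mul_mem_ball hω j hz

/-- The rotation average of a function bounded by `1` on the unit disc is bounded by `1`.
[cite: MckeeSmyth2021, Proposition 12.7 p.207] -/
theorem norm_rotAvg_le_one {k : ℕ} (hk : 1 ≤ k) {ω : ℂ} (hω : ‖ω‖ = 1) {h : ℂ → ℂ}
    (hb : ∀ z ∈ ball (0 : ℂ) 1, ‖h z‖ ≤ 1) {z : ℂ} (hz : z ∈ ball (0 : ℂ) 1) :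
    ‖(k : ℂ)⁻¹ * ∑ j ∈ Finset.range k, h (ω ^ j * z)‖ ≤ 1 := by
  have hk0 : (k : ℝ) ≠ 0 := by exact_mod_cast (by omega : k ≠ 0)
  rw [norm_mul, norm_inv, Complex.norm_natCast]
  have hsum : ‖∑ j ∈ Finset.range k, h (ω ^ j * z)‖ ≤ k := by
    calc ‖∑ j ∈ Finset.range k, h (ω ^ j * z)‖ ≤ ∑ j ∈ Finset.range k, ‖h (ω ^ j * z)‖ :=
          norm_sum_le _ _
      _ ≤ ∑ j ∈ Finset.range k, (1 : ℝ) :=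
          Finset.sum_le_sum fun j _ => hb _ (pow_mul_mem_ball hω j hz)
      _ = k := by simp
  calc (k : ℝ)⁻¹ * ‖∑ j ∈ Finset.range k, h (ω ^ j * z)‖ ≤ (k : ℝ)⁻¹ * k := by gcongr
    _ = 1 := inv_mul_cancel₀ hk0

/-- The rotation average is rotation invariant (`ω^k = 1`). [cite: MckeeSmyth2021, Proposition 12.7 p.207] -/
theorem rotAvg_rot (k : ℕ) {ω : ℂ} (hωk : ω ^ k = 1) (h : ℂ → ℂ) (z : ℂ) :
    (k : ℂ)⁻¹ * ∑ j ∈ Finset.range k, h (ω ^ j * (ω * z)) =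
      (k : ℂ)⁻¹ * ∑ j ∈ Finset.range k, h (ω ^ j * z) := by
  congr 1
  set F : ℕ → ℂ := fun j => h (ω ^ j * z) with hF
  have h1 : ∀ j, h (ω ^ j * (ω * z)) = F (j + 1) := by
    intro j; simp only [hF, pow_succ]; ring_nf
  simp_rw [h1]
  have h2 := Finset.sum_range_succ' F k
  have h3 := Finset.sum_range_succ F k
  have h4 : F k = F 0 := by simp [hF, hωk]
  rw [h4] at h3
  have : ∑ j ∈ Finset.range k, F (j + 1) = ∑ j ∈ Finset.range k, F j := by
    have := h2.symm.trans h3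
    exact add_right_cancel this
  simpa [hF] using this

/-- The rotation average at `0`. [cite: MckeeSmyth2021, Proposition 12.7 p.207] -/
theorem rotAvg_zero {k : ℕ} (hk : 1 ≤ k) (ω : ℂ) (h : ℂ → ℂ) :
    (k : ℂ)⁻¹ * ∑ j ∈ Finset.range k, h (ω ^ j * 0) = h 0 := by
  have hk0 : (k : ℂ) ≠ 0 := by exact_mod_cast (by omega : k ≠ 0)
  simp [Finset.sum_const, Finset.card_range, inv_mul_cancel_left₀ hk0]

/-! ### The key inequality -/

end Literature.Analysis.Complex

end Part4

/-!
## Part 5 — port of `Summits/Ventures/DiscreteObjects/Mahler/SchwarzPickHigher.lean`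

# Schwarz–Pick inequalities for the first Taylor coefficients of a Schur function
(venture `DiscreteObjects`, target L)

Cell `pub-namedobj`, seat `pub-namedobj-mahler` (gen 8). Framing: lottery ticket; floor = certified
bounds/negative ranges.

For `F` holomorphic on the open unit disc with `‖F‖ ≤ 1` there (`IsSchurClass F`, the tree's `Literature.Analysis.Complex.SchurAlgorithm.IsSchurClass`) and Taylor coefficients
`cₙ = jetCoeff F n` ([McKee–Smyth, *Around the Unit Circle*, Prop. 12.11 (b)–(d)], the coefficient
inequalities used in Smyth's proof that nonreciprocal integer polynomials have `M ≥ θ₀`):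

* `IsSchurClass.norm_jetCoeff_le` — `‖c_k‖ ≤ 1 - ‖c₀‖²` for every `k ≥ 1` (Prop. 12.11(b); from the flat
  case `SchwarzPickCoeff.norm_coeff_le_one_sub_norm_sq` of gen 7 by rotation averaging);
* `norm_le_one_on_ball_of_eq_pow_mul` — the order-`k` Schwarz lemma on the whole disc;
* `IsSchurClass.norm_jetCoeff_two_mul_le` — Prop. 12.11(c):
  `‖c_{2k} + c̄₀ c_k² /(1-‖c₀‖²)‖ ≤ 1 - ‖c₀‖² - ‖c_k‖²/(1-‖c₀‖²)` (`‖c₀‖ < 1`);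
* `IsSchurClass.jetCoeff_two_mul_le_real`, `IsSchurClass.real_le_jetCoeff_two_mul` — Prop. 12.11(d) for real
  coefficients: `-(1-c₀²) + c_k²/(1+c₀) ≤ c_{2k} ≤ 1 - c₀² - c_k²/(1-c₀)`.
-/

section Part5

namespace Literature.Analysis.Complex

open Literature.Analysis.Complex.SchurAlgorithm

open _root_.Polynomial _root_.Metric _root_.Set _root_.Filter _root_.Topology _root_.Asymptotics _root_.Finset
open scoped ComplexConjugate

noncomputable section

/-- A Schur function (`IsSchurClass F`: holomorphic on the open unit disc and bounded by `1` there — the tree's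
`Literature.Analysis.Complex.SchurAlgorithm.IsSchurClass`, REUSED; the source's two-field structure `IsSchurClass` is this conjunction) is
holomorphic on the disc: first projection, named as the source's field. [cite: MckeeSmyth2021, §12.1.1 p.206] -/
theorem SchurAlgorithm.IsSchurClass.differentiableOn {F : ℂ → ℂ} (hF : IsSchurClass F) : DifferentiableOn ℂ F (ball 0 1) := hF.1

/-- A Schur function is bounded by `1` on the open unit disc: second projection of `IsSchurClass`, named as the source's
field. [cite: MckeeSmyth2021, §12.1.1 p.206] -/
theorem SchurAlgorithm.IsSchurClass.norm_le {F : ℂ → ℂ} (hF : IsSchurClass F) : ∀ z ∈ ball (0 : ℂ) 1, ‖F z‖ ≤ 1 := hF.2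

namespace SchurAlgorithm.IsSchurClass

variable {F : ℂ → ℂ}

/-- `‖c₀‖ ≤ 1`. [cite: MckeeSmyth2021, Proposition 12.11 (b)–(d) p.207] -/
theorem norm_jetCoeff_zero_le (hF : IsSchurClass F) : ‖jetCoeff F 0‖ ≤ 1 :=
  hF.norm_le 0 (mem_ball_self one_pos)

/-- `-F` is Schur. [cite: MckeeSmyth2021, Proposition 12.11 (b)–(d) p.207] -/
theorem neg (hF : IsSchurClass F) : IsSchurClass (fun z => -F z) :=
  ⟨hF.differentiableOn.neg, fun z hz => by rw [norm_neg]; exact hF.norm_le z hz⟩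

/-- The rotation average of a Schur function is Schur. [cite: MckeeSmyth2021, Proposition 12.11 (b)–(d) p.207] -/
theorem rotAvg (hF : IsSchurClass F) {k : ℕ} (hk : 1 ≤ k) {ω : ℂ} (hω : ‖ω‖ = 1) :
    IsSchurClass (fun z => (k : ℂ)⁻¹ * ∑ j ∈ Finset.range k, F (ω ^ j * z)) :=
  ⟨differentiableOn_rotAvg k hω hF.differentiableOn,
    fun _ hz => norm_rotAvg_le_one hk hω hF.norm_le hz⟩

/-- Tails `jetTail F n` of a Schur function are holomorphic on the disc.
[cite: MckeeSmyth2021, Proposition 12.11 (b)–(d) p.207] -/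
theorem differentiableOn_jetTail (hF : IsSchurClass F) (n : ℕ) :
    DifferentiableOn ℂ (jetTail F n) (ball 0 1) :=
  Literature.Analysis.Complex.differentiableOn_jetTail one_pos hF.differentiableOn n

end SchurAlgorithm.IsSchurClass

/-- A primitive `k`-th root of unity in `ℂ` (`k ≥ 1`). [cite: MckeeSmyth2021, Proposition 12.11 (b)–(d) p.207] -/
theorem exists_isPrimitiveRoot {k : ℕ} (hk : 1 ≤ k) : ∃ ω : ℂ, IsPrimitiveRoot ω k :=
  ⟨_, Complex.isPrimitiveRoot_exp k (by omega)⟩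

/-- **Prop. 12.11(b)**: `‖c_k‖ ≤ 1 - ‖c₀‖²` for a Schur function and `k ≥ 1`.
[cite: MckeeSmyth2021, Proposition 12.11 (b)–(d) p.207] -/
theorem SchurAlgorithm.IsSchurClass.norm_jetCoeff_le {F : ℂ → ℂ} (hF : IsSchurClass F) {k : ℕ} (hk : 1 ≤ k) :
    ‖jetCoeff F k‖ ≤ 1 - ‖jetCoeff F 0‖ ^ 2 := by
  obtain ⟨ω, hω⟩ := exists_isPrimitiveRoot hk
  have hω1 : ‖ω‖ = 1 := hω.norm'_eq_one (by omega)
  set Φ : ℂ → ℂ := fun z => (k : ℂ)⁻¹ * ∑ j ∈ Finset.range k, F (ω ^ j * z) with hΦdef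
  have hΦ : IsSchurClass Φ := hF.rotAvg hk hω1
  have hcoef : ∀ n, jetCoeff Φ n = if k ∣ n then jetCoeff F n else 0 :=
    fun n => jetCoeff_rotAvg one_pos hF.differentiableOn hk hω n
  have h0 : jetCoeff Φ 0 = jetCoeff F 0 := by rw [hcoef]; simp
  have hkk : jetCoeff Φ k = jetCoeff F k := by rw [hcoef]; simp
  have hflat : ∀ n, 0 < n → n < k → jetCoeff Φ n = 0 := by
    intro n hn0 hnk
    rw [hcoef, if_neg (Nat.not_dvd_of_pos_of_lt hn0 hnk)]
  have hrep : ∀ z ∈ ball (0 : ℂ) 1, Φ z = jetCoeff F 0 + z ^ k * jetTail Φ k z := by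
    intro z _; rw [← h0]; exact eq_jetCoeff_zero_add_pow_mul Φ hk hflat z
  have h := norm_coeff_le_one_sub_norm_sq hk (hΦ.differentiableOn_jetTail k) hΦ.norm_le hrep
  rwa [jetTail_apply_zero, hkk] at h

/-- **Order-`k` Schwarz lemma on the whole disc.** If `Θ` maps the open unit disc into the closed unit
disc and `Θ z = z^k Ψ z` there with `Ψ` holomorphic and `k ≥ 1`, then `‖Ψ z‖ ≤ 1` on the disc.
[cite: MckeeSmyth2021, Proposition 12.11 (b)–(d) p.207] -/
theorem norm_le_one_on_ball_of_eq_pow_mul {Θ Ψ : ℂ → ℂ} {k : ℕ} (hk : 1 ≤ k)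
    (hΨ : DifferentiableOn ℂ Ψ (ball 0 1)) (hbd : ∀ z ∈ ball (0 : ℂ) 1, ‖Θ z‖ ≤ 1)
    (hrep : ∀ z ∈ ball (0 : ℂ) 1, Θ z = z ^ k * Ψ z) : ∀ z ∈ ball (0 : ℂ) 1, ‖Ψ z‖ ≤ 1 := by
  intro z hz
  by_cases hz0 : z = 0
  · subst hz0; exact norm_le_one_of_eq_pow_mul hk hΨ hbd hrep
  have hball : ball (0 : ℂ) 1 ∈ 𝓝 (0 : ℂ) := ball_mem_nhds _ one_pos
  have hΘd : DifferentiableOn ℂ Θ (ball 0 1) := by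
    have h1 : DifferentiableOn ℂ (fun z : ℂ => z ^ k * Ψ z) (ball 0 1) :=
      (differentiableOn_id.pow k).mul hΨ
    exact h1.congr hrep
  have hΘ0 : Θ 0 = 0 := by
    rw [hrep 0 (mem_ball_self one_pos)]; simp [zero_pow (by omega : k ≠ 0)]
  have hmaps : MapsTo Θ (ball (0 : ℂ) 1) (closedBall (Θ 0) 1) := by
    intro w hw
    rw [hΘ0, mem_closedBall, dist_zero_right]
    exact hbd w hw
  have hcontΨ : ContinuousAt Ψ 0 := (hΨ.differentiableAt hball).continuousAt
  have hlit : (fun w => Θ w - Θ 0) =o[𝓝 (0 : ℂ)] fun w => ‖w - 0‖ ^ (k - 1) := by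
    have hev : (fun w => Θ w - Θ 0) =ᶠ[𝓝 (0 : ℂ)] fun w => w ^ (k - 1) * (w * Ψ w) := by
      filter_upwards [hball] with w hw
      rw [hΘ0, sub_zero, hrep w hw, ← mul_assoc, ← pow_succ, Nat.sub_add_cancel hk]
    refine Asymptotics.IsLittleO.congr' ?_ hev.symm EventuallyEq.rfl
    have h1 : (fun w : ℂ => w ^ (k - 1)) =O[𝓝 (0 : ℂ)] fun w => ‖w - 0‖ ^ (k - 1) := by
      apply Asymptotics.IsBigO.of_bound 1
      filter_upwards with w
      simp
    have h2 : (fun w : ℂ => w * Ψ w) =o[𝓝 (0 : ℂ)] fun _ => (1 : ℝ) := by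
      rw [Asymptotics.isLittleO_one_iff]
      have : Tendsto (fun w : ℂ => w * Ψ w) (𝓝 0) (𝓝 (0 * Ψ 0)) :=
        (continuous_id.tendsto 0).mul hcontΨ
      simpa using this
    simpa using h1.mul_isLittleO h2
  have h := Complex.dist_le_mul_div_pow_of_mapsTo_ball_of_isLittleO hΘd hmaps hlit hz
  rw [Nat.sub_add_cancel hk, hΘ0, dist_zero_right, dist_zero_right, div_one, one_mul,
    hrep z hz, norm_mul, norm_pow] at h
  have hpos : 0 < ‖z‖ ^ k := pow_pos (norm_pos_iff.mpr hz0) k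
  by_contra hgt
  push Not at hgt
  have : ‖z‖ ^ k * 1 < ‖z‖ ^ k * ‖Ψ z‖ := mul_lt_mul_of_pos_left hgt hpos
  linarith

/-- Sums over `antidiagonal n` with a single surviving term `(n, 0)`.
[cite: MckeeSmyth2021, Proposition 12.11 (b)–(d) p.207] -/
theorem sum_antidiagonal_eq_fst {G D : ℕ → ℂ} (n : ℕ)
    (h : ∀ i j, i + j = n → 0 < j → G i * D j = 0) :
    ∑ ij ∈ antidiagonal n, G ij.1 * D ij.2 = G n * D 0 := by
  rw [Finset.sum_eq_single_of_mem (n, 0) (by simp)]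
  intro ij hij hne
  have hsum : ij.1 + ij.2 = n := by simpa using hij
  rcases Nat.eq_zero_or_pos ij.2 with h0 | hpos
  · exfalso; apply hne
    ext
    · simp; omega
    · simp; omega
  · exact h ij.1 ij.2 hsum hpos

/-- **Prop. 12.11(c).**  For a Schur function with `‖c₀‖ < 1` and `k ≥ 1`:
`‖c_{2k} + c̄₀ c_k²/(1-‖c₀‖²)‖ ≤ 1 - ‖c₀‖² - ‖c_k‖²/(1-‖c₀‖²)`.
[cite: MckeeSmyth2021, Proposition 12.11 (b)–(d) p.207] -/
theorem SchurAlgorithm.IsSchurClass.norm_jetCoeff_two_mul_le {F : ℂ → ℂ} (hF : IsSchurClass F) {k : ℕ} (hk : 1 ≤ k)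
    (h0 : ‖jetCoeff F 0‖ < 1) :
    ‖jetCoeff F (2 * k) + conj (jetCoeff F 0) * jetCoeff F k ^ 2 / (1 - ‖jetCoeff F 0‖ ^ 2)‖ ≤
      1 - ‖jetCoeff F 0‖ ^ 2 - ‖jetCoeff F k‖ ^ 2 / (1 - ‖jetCoeff F 0‖ ^ 2) := by
  obtain ⟨ω, hω⟩ := exists_isPrimitiveRoot hk
  have hω1 : ‖ω‖ = 1 := hω.norm'_eq_one (by omega)
  have hball : ball (0 : ℂ) 1 ∈ 𝓝 (0 : ℂ) := ball_mem_nhds _ one_pos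
  -- the flat rotation average `Φ` with the same coefficients `c₀, c_k, c_{2k}`
  set Φ : ℂ → ℂ := fun z => (k : ℂ)⁻¹ * ∑ j ∈ Finset.range k, F (ω ^ j * z) with hΦdef
  have hΦ : IsSchurClass Φ := hF.rotAvg hk hω1
  have hcoef : ∀ n, jetCoeff Φ n = if k ∣ n then jetCoeff F n else 0 :=
    fun n => jetCoeff_rotAvg one_pos hF.differentiableOn hk hω n
  set a : ℂ := jetCoeff F 0 with ha
  set ck : ℂ := jetCoeff F k with hck
  set c2k : ℂ := jetCoeff F (2 * k) with hc2k
  have hΦ0 : jetCoeff Φ 0 = a := by rw [hcoef]; simp [ha]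
  have hΦk : jetCoeff Φ k = ck := by rw [hcoef]; simp [hck]
  have hΦ2k : jetCoeff Φ (2 * k) = c2k := by rw [hcoef]; simp [hc2k]
  have hΦoff : ∀ n, ¬ k ∣ n → jetCoeff Φ n = 0 := fun n hn => by rw [hcoef, if_neg hn]
  have hΦval : Φ 0 = a := by have h := hΦ0; rwa [jetCoeff_zero] at h
  -- the real quantity `D = 1 - ‖a‖²`
  set D : ℝ := 1 - ‖a‖ ^ 2 with hD
  have hDpos : 0 < D := by rw [hD]; nlinarith [norm_nonneg a]
  have hDC : (1 : ℂ) - conj a * a = (D : ℂ) := by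
    rw [hD, Complex.conj_mul' a]; push_cast; ring
  -- the Möbius transform `G = (Φ - a)/(1 - ā Φ)` and its denominator `Dn`
  set Dn : ℂ → ℂ := fun z => 1 - conj a * Φ z with hDn
  have hDn_ne : ∀ z ∈ ball (0 : ℂ) 1, Dn z ≠ 0 := by
    intro z hz
    have h1 : ‖conj a * Φ z‖ < 1 := by
      rw [norm_mul, Complex.norm_conj]
      calc ‖a‖ * ‖Φ z‖ ≤ ‖a‖ * 1 := by gcongr; exact hΦ.norm_le z hz
        _ < 1 := by rw [mul_one]; exact h0
    intro h
    have : conj a * Φ z = 1 := by rw [hDn] at h; exact (sub_eq_zero.mp h).symm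
    rw [this, norm_one] at h1
    exact lt_irrefl _ h1
  have hDnd : DifferentiableOn ℂ Dn (ball 0 1) :=
    (hΦ.differentiableOn.const_mul (conj a)).const_sub (1 : ℂ)
  set G : ℂ → ℂ := fun z => (Φ z - a) / Dn z with hG
  have hGd : DifferentiableOn ℂ G (ball 0 1) := (hΦ.differentiableOn.sub_const a).div hDnd hDn_ne
  have hGb : ∀ z ∈ ball (0 : ℂ) 1, ‖G z‖ ≤ 1 :=
    fun z hz => norm_moebius_le_one h0 (hΦ.norm_le z hz)
  have hGS : IsSchurClass G := ⟨hGd, hGb⟩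
  -- coefficients of `Dn` and of `Φ - a`
  have hDn0 : jetCoeff Dn 0 = (D : ℂ) := by
    rw [jetCoeff_zero, hDn]; simp only; rw [hΦval, hDC]
  have hDnS : ∀ n, 0 < n → jetCoeff Dn n = -(conj a * jetCoeff Φ n) := by
    intro n hn
    have h1 := jetCoeff_sub one_pos (differentiableOn_const (1 : ℂ))
      (hΦ.differentiableOn.const_mul (conj a)) n
    have h2 := jetCoeff_const_mul one_pos hΦ.differentiableOn (conj a) n
    have h3 := jetCoeff_const (1 : ℂ) n
    rw [if_neg (by omega)] at h3
    have : jetCoeff Dn n = jetCoeff (fun z => (fun _ : ℂ => (1 : ℂ)) z - (fun w => conj a * Φ w) z) n := rfl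
    rw [this, h1, h2, h3, zero_sub]
  have hΦa : ∀ n, jetCoeff (fun z => Φ z - a) n = jetCoeff Φ n - if n = 0 then a else 0 := by
    intro n
    have h1 := jetCoeff_sub one_pos hΦ.differentiableOn (differentiableOn_const a) n
    rw [jetCoeff_const] at h1
    exact h1
  -- the identity `G · Dn = Φ - a` on the disc and the resulting convolution relations
  have hGDn : ∀ n, jetCoeff (fun z => Φ z - a) n =
      ∑ ij ∈ antidiagonal n, jetCoeff G ij.1 * jetCoeff Dn ij.2 := by
    intro n
    rw [← jetCoeff_mul one_pos hGd hDnd n]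
    apply jetCoeff_congr one_pos (hGd.mul hDnd)
    intro z hz
    show Φ z - a = G z * Dn z
    rw [hG]; simp only; field_simp [hDn_ne z hz]
  have hG0 : jetCoeff G 0 = 0 := by
    rw [jetCoeff_zero, hG]; simp only; rw [hΦval, sub_self, zero_div]
  -- `Dn_j = 0` for `0 < j`, `k ∤ j`
  have hDn_off : ∀ j, 0 < j → ¬ k ∣ j → jetCoeff Dn j = 0 := by
    intro j hj hkj; rw [hDnS j hj, hΦoff j hkj, mul_zero, neg_zero]
  -- `G_n = 0` for `n < k`
  have hGflat : ∀ n, n < k → jetCoeff G n = 0 := by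
    intro n hnk
    rcases Nat.eq_zero_or_pos n with rfl | hn0
    · exact hG0
    have h := hGDn n
    rw [sum_antidiagonal_eq_fst n (fun i j hij hj =>
      by rw [hDn_off j hj (Nat.not_dvd_of_pos_of_lt hj (by omega)), mul_zero]), hDn0,
      hΦa, if_neg (by omega), sub_zero, hΦoff n (Nat.not_dvd_of_pos_of_lt hn0 hnk)] at h
    have hD0 : (D : ℂ) ≠ 0 := by exact_mod_cast hDpos.ne'
    exact (mul_eq_zero.mp h.symm).resolve_right hD0
  -- `G_k · D = c_k`
  have hGk : jetCoeff G k * (D : ℂ) = ck := by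
    have h := hGDn k
    rw [sum_antidiagonal_eq_fst k (fun i j hij hj => by
      rcases eq_or_ne j k with rfl | hjk
      · rw [show i = 0 by omega, hG0, zero_mul]
      · rw [hDn_off j hj (fun hd => hjk (Nat.eq_of_dvd_of_lt_two_mul (by omega) hd (by omega))),
          mul_zero]), hDn0, hΦa, if_neg (by omega), sub_zero, hΦk] at h
    exact h.symm
  -- `G_{2k} · D - ā c_k G_k = c_{2k}`
  have hG2k : jetCoeff G (2 * k) * (D : ℂ) - conj a * ck * jetCoeff G k = c2k := by
    have h := hGDn (2 * k)
    rw [Finset.sum_eq_add_of_mem (2 * k, 0) (k, k) (by simp) (by simp [two_mul])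
      (by intro e; have := (Prod.ext_iff.mp e).2; simp at this; omega) ?rest] at h
    · rw [hDn0, hDnS k (by omega), hΦk, hΦa, if_neg (by omega), sub_zero, hΦ2k] at h
      linear_combination -h
    · intro ij hij hne
      have hsum : ij.1 + ij.2 = 2 * k := by simpa using hij
      rcases Nat.eq_zero_or_pos ij.2 with hj0 | hjpos
      · exfalso; apply hne.1; ext <;> simp <;> omega
      rcases eq_or_ne ij.2 k with hjk | hjk
      · exfalso; apply hne.2; ext <;> simp <;> omega
      rcases eq_or_ne ij.2 (2 * k) with hj2 | hj2
      · rw [show ij.1 = 0 by omega, hG0, zero_mul]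
      · rw [hDn_off ij.2 hjpos ?_, mul_zero]
        intro hd
        obtain ⟨m, hm⟩ := hd
        have : m < 2 := by
          by_contra hm2; push Not at hm2
          have : k * m ≥ k * 2 := Nat.mul_le_mul_left k hm2
          omega
        interval_cases m <;> omega
  -- `G = z^k Ψ` with `Ψ` Schur
  set Ψ := jetTail G k with hΨ
  have hGrep : ∀ z ∈ ball (0 : ℂ) 1, G z = z ^ k * Ψ z := by
    intro z _
    have := eq_jetCoeff_zero_add_pow_mul G hk (fun n hn0 hnk => hGflat n hnk) z
    rw [this, hG0, zero_add]
  have hΨd : DifferentiableOn ℂ Ψ (ball 0 1) := hGS.differentiableOn_jetTail k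
  have hΨS : IsSchurClass Ψ := ⟨hΨd, norm_le_one_on_ball_of_eq_pow_mul hk hΨd hGb hGrep⟩
  have hineq := hΨS.norm_jetCoeff_le hk
  rw [hΨ, jetCoeff_jetTail, jetCoeff_jetTail, add_zero, ← two_mul] at hineq
  -- final algebra
  set X := jetCoeff G (2 * k) with hX
  set Y := jetCoeff G k with hY
  have hD0 : (D : ℂ) ≠ 0 := by exact_mod_cast hDpos.ne'
  have hDC' : (1 : ℂ) - ((‖a‖ : ℝ) : ℂ) ^ 2 = (D : ℂ) := by rw [hD]; push_cast; ring
  have hYeq : Y = ck / (D : ℂ) := by rw [← hGk]; field_simp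
  have hXeq : c2k + conj a * ck ^ 2 / (D : ℂ) = X * (D : ℂ) := by
    rw [← hG2k, hYeq]; field_simp; ring
  have hnormY : ‖Y‖ = ‖ck‖ / D := by
    rw [hYeq, norm_div, Complex.norm_real, Real.norm_eq_abs, abs_of_pos hDpos]
  have hnormD : ‖(D : ℂ)‖ = D := by rw [Complex.norm_real, Real.norm_eq_abs, abs_of_pos hDpos]
  rw [show (1 : ℂ) - (‖a‖ : ℂ) ^ 2 = (D : ℂ) from hDC', hXeq, norm_mul, hnormD]
  rw [hnormY] at hineq
  have : ‖ck‖ ^ 2 / D = D * (‖ck‖ / D) ^ 2 := by field_simp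
  rw [this]
  have h2 := mul_le_mul_of_nonneg_right hineq hDpos.le
  nlinarith [h2]

/-- **Prop. 12.11(d)** (real coefficients): if `c₀ = a`, `c_k = u`, `c_{2k} = v` are real, `|a| < 1`,
then `v ≤ 1 - a² - u²/(1-a)` and `-(1-a²) + u²/(1+a) ≤ v`. [cite: MckeeSmyth2021, Proposition 12.11 (b)–(d) p.207] -/
theorem SchurAlgorithm.IsSchurClass.jetCoeff_two_mul_real_bounds {F : ℂ → ℂ} (hF : IsSchurClass F) {k : ℕ} (hk : 1 ≤ k)
    {a u v : ℝ} (ha : jetCoeff F 0 = a) (hu : jetCoeff F k = u) (hv : jetCoeff F (2 * k) = v)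
    (ha1 : |a| < 1) :
    v ≤ 1 - a ^ 2 - u ^ 2 / (1 - a) ∧ -(1 - a ^ 2) + u ^ 2 / (1 + a) ≤ v := by
  have h0 : ‖jetCoeff F 0‖ < 1 := by rwa [ha, Complex.norm_real, Real.norm_eq_abs]
  have key := hF.norm_jetCoeff_two_mul_le hk h0
  rw [ha, hu, hv, Complex.norm_real, Complex.norm_real, Real.norm_eq_abs, Real.norm_eq_abs,
    sq_abs, sq_abs] at key
  have e : ((v : ℂ) + conj (a : ℂ) * (u : ℂ) ^ 2 / (1 - ((|a| : ℝ) : ℂ) ^ 2)) =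
      ((v + a * u ^ 2 / (1 - a ^ 2) : ℝ) : ℂ) := by
    rw [Complex.conj_ofReal]
    have h2 : ((|a| : ℝ) : ℂ) ^ 2 = ((a ^ 2 : ℝ) : ℂ) := by
      rw [← Complex.ofReal_pow, sq_abs]
    rw [h2]; push_cast; ring
  rw [e, Complex.norm_real, Real.norm_eq_abs] at key
  have ha' := abs_lt.mp ha1
  have h1a : 0 < 1 - a := by linarith
  have h1a' : 0 < 1 + a := by linarith
  have h1a2 : 1 - a ^ 2 = (1 - a) * (1 + a) := by ring
  obtain ⟨hlo, hhi⟩ := abs_le.mp key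
  constructor
  · have : 1 - a ^ 2 - u ^ 2 / (1 - a ^ 2) - a * u ^ 2 / (1 - a ^ 2) = 1 - a ^ 2 - u ^ 2 / (1 - a) := by
      rw [h1a2]; field_simp; ring
    linarith
  · have : -(1 - a ^ 2 - u ^ 2 / (1 - a ^ 2)) - a * u ^ 2 / (1 - a ^ 2) =
        -(1 - a ^ 2) + u ^ 2 / (1 + a) := by
      rw [h1a2]; field_simp; ring
    linarith

end

end Literature.Analysis.Complex

end Part5

/-!
## Part 6 — port of `Summits/Ventures/DiscreteObjects/Mahler/HardyContraction.lean`

# Multiplication by a Schur function contracts `H²`: a Parseval inequality for Taylor coefficients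
(venture `DiscreteObjects`, target L)

Cell `pub-namedobj`, seat `pub-namedobj-mahler` (gen 8). Framing: lottery ticket; floor = certified
bounds/negative ranges.

For a Schur function `F` (holomorphic on the unit disc, `‖F‖ ≤ 1`) and a complex polynomial `p`,
the Taylor coefficients `eₙ` of `p · F` satisfy, for every `N`,

  `Σ_{n<N} ‖eₙ‖² ≤ Σₙ ‖pₙ‖²`        (`hardy_contraction`)

([McKee–Smyth, *Around the Unit Circle*, Prop. 12.11(a) and its use in §12.2.2 via Parseval's
identity]).  Proof: on the circle `|z| = r < 1` write `pF = E + z^N Θ` with `E` the Taylor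
polynomial (`TaylorJet.jet_eq`); by orthogonality of `e^{inθ}` (`integral_exp_int_mul`),
`∫|E|² = 2π Σ ‖eₙ‖² r^{2n}`, the cross term `∫ conj(E) z^N Θ` vanishes by Cauchy's theorem
(`integral_exp_mul_eq_zero`), and `∫ |pF|² ≤ ∫ |p|² = 2π Σ ‖pₙ‖² r^{2n}`; finally `r → 1`.
-/

section Part6

namespace Literature.Analysis.Complex

open Literature.Analysis.Complex.SchurAlgorithm

open _root_.Polynomial _root_.Metric _root_.Set _root_.Filter _root_.Topology _root_.Finset _root_.MeasureTheory intervalIntegral _root_.Complex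
open scoped ComplexConjugate _root_.Real Interval

noncomputable section

/-! ### Orthogonality on the circle -/

/-- `∫₀^{2π} e^{i m θ} dθ = 2π` if `m = 0` and `0` otherwise (`m ∈ ℤ`).
[cite: MckeeSmyth2021, Proposition 12.11 (a) p.207; Theorem C.2 (Parseval) p.345] -/
theorem integral_exp_int_mul (m : ℤ) :
    ∫ θ in (0 : ℝ)..2 * π, cexp (m * θ * I) = if m = 0 then (2 * π : ℂ) else 0 := by
  split_ifs with hm
  · subst hm; simp
  · have hc : (m : ℂ) * I ≠ 0 := mul_ne_zero (by exact_mod_cast hm) I_ne_zero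
    have h := integral_exp_mul_complex (a := 0) (b := 2 * π) hc
    have e : ∀ θ : ℝ, cexp (m * θ * I) = cexp ((m : ℂ) * I * θ) := fun θ => by ring_nf
    simp_rw [e]
    rw [h]
    have h1 : cexp ((m : ℂ) * I * (2 * π : ℝ)) = 1 := by
      have := Complex.exp_int_mul_two_pi_mul_I m
      rw [← this]; congr 1; push_cast; ring
    rw [h1]; simp

/-- The point `r e^{iθ}` of the circle of radius `r`.
[cite: MckeeSmyth2021, Proposition 12.11 (a) p.207; Theorem C.2 (Parseval) p.345] -/
def circPt (r θ : ℝ) : ℂ := r * cexp (θ * I)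

/-- `circPt r θ = circleMap 0 r θ`.
[cite: MckeeSmyth2021, Proposition 12.11 (a) p.207; Theorem C.2 (Parseval) p.345] -/
theorem circPt_eq_circleMap (r θ : ℝ) : circPt r θ = circleMap 0 r θ := by
  rw [circleMap_zero]; rfl

/-- Continuity of `θ ↦ r e^{iθ}`. [cite: MckeeSmyth2021, Proposition 12.11 (a) p.207; Theorem C.2 (Parseval) p.345] -/
theorem continuous_circPt (r : ℝ) : Continuous (circPt r) := by
  unfold circPt; fun_prop

/-- `‖r e^{iθ}‖ = |r|`. [cite: MckeeSmyth2021, Proposition 12.11 (a) p.207; Theorem C.2 (Parseval) p.345] -/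
theorem norm_circPt (r θ : ℝ) : ‖circPt r θ‖ = |r| := by
  rw [circPt, norm_mul, Complex.norm_real, Real.norm_eq_abs, Complex.norm_exp_ofReal_mul_I, mul_one]

/-- For `0 ≤ r < 1` the circle of radius `r` lies in the unit disc.
[cite: MckeeSmyth2021, Proposition 12.11 (a) p.207; Theorem C.2 (Parseval) p.345] -/
theorem circPt_mem_ball {r : ℝ} (hr0 : 0 ≤ r) (hr1 : r < 1) (θ : ℝ) : circPt r θ ∈ ball (0 : ℂ) 1 := by
  rw [mem_ball_zero_iff, norm_circPt, abs_of_nonneg hr0]; exact hr1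

/-- Powers on the circle: `(r e^{iθ})ⁿ = rⁿ e^{inθ}`.
[cite: MckeeSmyth2021, Proposition 12.11 (a) p.207; Theorem C.2 (Parseval) p.345] -/
theorem circPt_pow (r θ : ℝ) (n : ℕ) : circPt r θ ^ n = (r : ℂ) ^ n * cexp (n * θ * I) := by
  rw [circPt, mul_pow, ← Complex.exp_nat_mul]; ring_nf

/-- `(r e^{iθ})ⁿ · conj((r e^{iθ})ᵐ) = r^{n+m} e^{i(n-m)θ}`.
[cite: MckeeSmyth2021, Proposition 12.11 (a) p.207; Theorem C.2 (Parseval) p.345] -/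
theorem circPt_pow_mul_conj_pow (r θ : ℝ) (n m : ℕ) :
    circPt r θ ^ n * conj (circPt r θ ^ m) = (r : ℂ) ^ (n + m) * cexp (((n : ℤ) - m : ℤ) * θ * I) := by
  rw [circPt_pow, circPt_pow, map_mul, map_pow, Complex.conj_ofReal, ← Complex.exp_conj]
  have : conj ((m : ℂ) * θ * I) = -(m * θ * I) := by
    rw [map_mul, map_mul, Complex.conj_I, Complex.conj_ofReal, map_natCast]; ring
  rw [this, pow_add]
  have e : cexp ((n : ℂ) * θ * I) * cexp (-((m : ℂ) * θ * I)) = cexp ((((n : ℤ) - m : ℤ) : ℂ) * θ * I) := by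
    rw [← Complex.exp_add]; congr 1; push_cast; ring
  calc (r : ℂ) ^ n * cexp (n * θ * I) * ((r : ℂ) ^ m * cexp (-(m * θ * I)))
      = (r : ℂ) ^ n * (r : ℂ) ^ m * (cexp (n * θ * I) * cexp (-(m * θ * I))) := by ring
    _ = (r : ℂ) ^ n * (r : ℂ) ^ m * cexp ((((n : ℤ) - m : ℤ) : ℂ) * θ * I) := by rw [e]

/-- **Orthogonality**: `∫₀^{2π} |Σ_{n<D} qₙ (re^{iθ})ⁿ|² dθ = 2π Σ_{n<D} ‖qₙ‖² r^{2n}` (complex form).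
[cite: MckeeSmyth2021, Proposition 12.11 (a) p.207; Theorem C.2 (Parseval) p.345] -/
theorem integral_conj_mul_sum (q : ℕ → ℂ) (D : ℕ) (r : ℝ) :
    ∫ θ in (0 : ℝ)..2 * π, conj (∑ n ∈ range D, q n * circPt r θ ^ n) *
        (∑ n ∈ range D, q n * circPt r θ ^ n) =
      (2 * π : ℂ) * ∑ n ∈ range D, (‖q n‖ ^ 2 : ℝ) * r ^ (2 * n) := by
  -- expand the product into a double sum of monomials
  have hexp : ∀ θ : ℝ, conj (∑ n ∈ range D, q n * circPt r θ ^ n) * (∑ n ∈ range D, q n * circPt r θ ^ n)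
      = ∑ n ∈ range D, ∑ m ∈ range D,
          (q m * conj (q n) * (r : ℂ) ^ (m + n)) * cexp (((m : ℤ) - n : ℤ) * θ * I) := by
    intro θ
    rw [map_sum, Finset.sum_mul]
    apply Finset.sum_congr rfl; intro n _
    rw [Finset.mul_sum]
    apply Finset.sum_congr rfl; intro m _
    rw [map_mul]
    have h := circPt_pow_mul_conj_pow r θ m n
    linear_combination (q m * conj (q n)) * h
  simp_rw [hexp]
  have hint : ∀ n m : ℕ, IntervalIntegrable
      (fun θ : ℝ => (q m * conj (q n) * (r : ℂ) ^ (m + n)) * cexp (((m : ℤ) - n : ℤ) * θ * I))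
      volume 0 (2 * π) := by
    intro n m; apply Continuous.intervalIntegrable; fun_prop
  rw [intervalIntegral.integral_finsetSum (fun n _ => Continuous.intervalIntegrable (by fun_prop) _ _)]
  rw [Complex.ofReal_sum, Finset.mul_sum]
  apply Finset.sum_congr rfl; intro n hn
  rw [intervalIntegral.integral_finsetSum (fun m _ => hint n m)]
  simp_rw [intervalIntegral.integral_const_mul, integral_exp_int_mul]
  rw [Finset.sum_eq_single_of_mem n hn]
  · rw [if_pos (by simp), Complex.mul_conj']; push_cast; ring
  · intro m _ hmn
    rw [if_neg (by omega), mul_zero]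

/-- **Orthogonality** (real form): `∫₀^{2π} ‖Σ_{n<D} qₙ (re^{iθ})ⁿ‖² dθ = 2π Σ_{n<D} ‖qₙ‖² r^{2n}`.
[cite: MckeeSmyth2021, Proposition 12.11 (a) p.207; Theorem C.2 (Parseval) p.345] -/
theorem integral_norm_sq_sum (q : ℕ → ℂ) (D : ℕ) (r : ℝ) :
    ∫ θ in (0 : ℝ)..2 * π, ‖∑ n ∈ range D, q n * circPt r θ ^ n‖ ^ 2 =
      2 * π * ∑ n ∈ range D, ‖q n‖ ^ 2 * r ^ (2 * n) := by
  have h := integral_conj_mul_sum q D r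
  simp_rw [Complex.conj_mul', ← Complex.ofReal_pow] at h
  rw [intervalIntegral.integral_ofReal] at h
  exact_mod_cast h

/-! ### The cross term vanishes (Cauchy) -/

/-- For `Θ` holomorphic on the unit disc, `0 < r < 1` and `j ≥ 1`:
`∫₀^{2π} e^{ijθ} Θ(re^{iθ}) dθ = 0`.
[cite: MckeeSmyth2021, Proposition 12.11 (a) p.207; Theorem C.2 (Parseval) p.345] -/
theorem integral_exp_mul_eq_zero {Θ : ℂ → ℂ} (hΘ : DifferentiableOn ℂ Θ (ball 0 1)) {r : ℝ}
    (hr0 : 0 < r) (hr1 : r < 1) {j : ℕ} (hj : 1 ≤ j) :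
    ∫ θ in (0 : ℝ)..2 * π, cexp (j * θ * I) * Θ (circPt r θ) = 0 := by
  -- Cauchy's theorem for `z ↦ z^(j-1) Θ z` on the closed disc of radius `r`
  have hsub : closedBall (0 : ℂ) r ⊆ ball 0 1 := closedBall_subset_ball hr1
  set g : ℂ → ℂ := fun z => z ^ (j - 1) * Θ z with hg
  have hgc : ContinuousOn g (closedBall 0 r) :=
    ((continuousOn_id.pow _).mul (hΘ.continuousOn.mono hsub))
  have hgd : ∀ z ∈ ball (0 : ℂ) r \ ∅, DifferentiableAt ℂ g z := by
    intro z hz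
    have hz' : z ∈ ball (0 : ℂ) 1 := ball_subset_ball hr1.le hz.1
    exact ((differentiableAt_id.pow _).mul (hΘ.differentiableAt (isOpen_ball.mem_nhds hz')))
  have hC := Complex.circleIntegral_eq_zero_of_differentiable_on_off_countable hr0.le
    Set.countable_empty hgc hgd
  -- unfold the circle integral
  rw [circleIntegral] at hC
  have e : ∀ θ : ℝ, deriv (circleMap 0 r) θ • g (circleMap 0 r θ) =
      ((r : ℂ) ^ j * I) * (cexp (j * θ * I) * Θ (circPt r θ)) := by
    intro θ
    rw [deriv_circleMap, ← circPt_eq_circleMap, smul_eq_mul, hg]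
    simp only
    rw [circPt_pow]
    have hj' : ((j - 1 : ℕ) : ℂ) = (j : ℂ) - 1 := by
      rw [Nat.cast_sub hj]; simp
    rw [hj', circPt]
    have : (r : ℂ) ^ j = (r : ℂ) ^ (j - 1) * r := by
      rw [← pow_succ, Nat.sub_add_cancel hj]
    rw [this]
    have e2 : cexp (θ * I) * cexp (((j : ℂ) - 1) * θ * I) = cexp (j * θ * I) := by
      rw [← Complex.exp_add]; congr 1; ring
    calc (r : ℂ) * cexp (θ * I) * I * ((r : ℂ) ^ (j - 1) * cexp (((j : ℂ) - 1) * θ * I) *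
          Θ (r * cexp (θ * I)))
        = (r : ℂ) ^ (j - 1) * r * I * ((cexp (θ * I) * cexp (((j : ℂ) - 1) * θ * I)) *
          Θ (r * cexp (θ * I))) := by ring
      _ = _ := by rw [e2]
  simp_rw [e] at hC
  rw [intervalIntegral.integral_const_mul] at hC
  have hne : (r : ℂ) ^ j * I ≠ 0 :=
    mul_ne_zero (pow_ne_zero _ (by exact_mod_cast hr0.ne')) I_ne_zero
  exact (mul_eq_zero.mp hC).resolve_left hne

/-- The cross term: for a polynomial part `E = Σ_{n<N} eₙ zⁿ` and `Θ` holomorphic on the disc,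
`∫₀^{2π} conj(E(w)) · w^N Θ(w) dθ = 0` (`w = re^{iθ}`, `0 < r < 1`).
[cite: MckeeSmyth2021, Proposition 12.11 (a) p.207; Theorem C.2 (Parseval) p.345] -/
theorem integral_cross_eq_zero (e : ℕ → ℂ) (N : ℕ) {Θ : ℂ → ℂ} (hΘ : DifferentiableOn ℂ Θ (ball 0 1))
    {r : ℝ} (hr0 : 0 < r) (hr1 : r < 1) :
    ∫ θ in (0 : ℝ)..2 * π, conj (∑ n ∈ range N, e n * circPt r θ ^ n) *
      (circPt r θ ^ N * Θ (circPt r θ)) = 0 := by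
  have hΘc : Continuous fun θ : ℝ => Θ (circPt r θ) :=
    hΘ.continuousOn.comp_continuous (continuous_circPt r) (fun θ => circPt_mem_ball hr0.le hr1 θ)
  have hexp : ∀ θ : ℝ, conj (∑ n ∈ range N, e n * circPt r θ ^ n) * (circPt r θ ^ N * Θ (circPt r θ))
      = ∑ n ∈ range N, (conj (e n) * (r : ℂ) ^ (N + n)) *
          (cexp (((N - n : ℕ) : ℕ) * θ * I) * Θ (circPt r θ)) := by
    intro θ
    rw [map_sum, Finset.sum_mul]
    apply Finset.sum_congr rfl; intro n hn
    have hnN : n ≤ N := (Finset.mem_range.mp hn).le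
    rw [map_mul]
    have h := circPt_pow_mul_conj_pow r θ N n
    have hcast : (((N : ℤ) - n : ℤ) : ℂ) = (((N - n : ℕ) : ℕ) : ℂ) := by
      rw [Nat.cast_sub hnN]; push_cast; ring
    rw [hcast] at h
    calc conj (e n) * conj (circPt r θ ^ n) * (circPt r θ ^ N * Θ (circPt r θ))
        = conj (e n) * (circPt r θ ^ N * conj (circPt r θ ^ n)) * Θ (circPt r θ) := by ring
      _ = _ := by rw [h]; ring
  simp_rw [hexp]
  have hint : ∀ n ∈ range N, IntervalIntegrable (fun θ : ℝ => (conj (e n) * (r : ℂ) ^ (N + n)) *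
      (cexp (((N - n : ℕ) : ℕ) * θ * I) * Θ (circPt r θ))) volume 0 (2 * π) := by
    intro n _
    apply Continuous.intervalIntegrable
    exact continuous_const.mul ((by fun_prop : Continuous fun θ : ℝ => cexp (((N - n : ℕ) : ℕ) * θ * I)).mul hΘc)
  rw [intervalIntegral.integral_finsetSum hint]
  apply Finset.sum_eq_zero; intro n hn
  rw [intervalIntegral.integral_const_mul,
    integral_exp_mul_eq_zero hΘ hr0 hr1 (j := N - n) (by have := Finset.mem_range.mp hn; omega),
    mul_zero]

/-! ### The contraction inequality -/

/-- **`H²`-contraction.**  For a Schur function `F` and a polynomial `p`, the Taylor coefficients of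
`p · F` satisfy `Σ_{n<N} ‖eₙ‖² ≤ Σ_{n ≤ deg p} ‖pₙ‖²` for every `N`.
[cite: MckeeSmyth2021, Proposition 12.11 (a) p.207; Theorem C.2 (Parseval) p.345] -/
theorem hardy_contraction {F : ℂ → ℂ} (hF : IsSchurClass F) (p : ℂ[X]) (N : ℕ) :
    ∑ n ∈ range N, ‖jetCoeff (fun z => p.eval z * F z) n‖ ^ 2 ≤
      ∑ n ∈ range (p.natDegree + 1), ‖p.coeff n‖ ^ 2 := by
  set G : ℂ → ℂ := fun z => p.eval z * F z with hGdef
  have hGd : DifferentiableOn ℂ G (ball 0 1) := (p.differentiable.differentiableOn).mul hF.differentiableOn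
  set e : ℕ → ℂ := fun n => jetCoeff G n with hedef
  set Θ := jetTail G N with hΘdef
  have hΘd : DifferentiableOn ℂ Θ (ball 0 1) := differentiableOn_jetTail one_pos hGd N
  set B : ℝ := ∑ n ∈ range (p.natDegree + 1), ‖p.coeff n‖ ^ 2 with hB
  -- the bound on each circle of radius `r < 1`
  have hcirc : ∀ r : ℝ, 0 < r → r < 1 → ∑ n ∈ range N, ‖e n‖ ^ 2 * r ^ (2 * n) ≤ B := by
    intro r hr0 hr1
    have hmem : ∀ θ : ℝ, circPt r θ ∈ ball (0 : ℂ) 1 := circPt_mem_ball hr0.le hr1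
    -- continuity of the players on the circle
    have hFc : Continuous fun θ : ℝ => F (circPt r θ) :=
      hF.differentiableOn.continuousOn.comp_continuous (continuous_circPt r) hmem
    have hΘc : Continuous fun θ : ℝ => Θ (circPt r θ) :=
      hΘd.continuousOn.comp_continuous (continuous_circPt r) hmem
    have hEc : Continuous fun θ : ℝ => ∑ n ∈ range N, e n * circPt r θ ^ n := by
      have := continuous_circPt r; fun_prop
    have hpc : Continuous fun θ : ℝ => p.eval (circPt r θ) :=
      p.continuous.comp (continuous_circPt r)
    -- pointwise decomposition `G = E + w^N Θ`
    have hdec : ∀ θ : ℝ, G (circPt r θ) =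
        (∑ n ∈ range N, e n * circPt r θ ^ n) + circPt r θ ^ N * Θ (circPt r θ) :=
      fun θ => jet_eq G N (circPt r θ)
    -- (1) `∫ ‖E‖² = 2π Σ ‖eₙ‖² r^{2n}`
    have h1 := integral_norm_sq_sum e N r
    -- (2) `∫ ‖E‖² ≤ ∫ ‖G‖²`
    set v : ℝ → ℂ := fun θ => circPt r θ ^ N * Θ (circPt r θ) with hv
    have hvc : Continuous v := ((continuous_circPt r).pow N).mul hΘc
    have hcross : ∫ θ in (0 : ℝ)..2 * π,
        (conj (∑ n ∈ range N, e n * circPt r θ ^ n) * v θ).re = 0 := by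
      have hint : IntervalIntegrable (fun θ : ℝ => conj (∑ n ∈ range N, e n * circPt r θ ^ n) * v θ)
          volume 0 (2 * π) :=
        (Continuous.intervalIntegrable (by fun_prop) _ _)
      have h := Complex.reCLM.intervalIntegral_comp_comm hint
      simp only [Complex.reCLM_apply] at h
      rw [h, hv]
      simp only
      rw [integral_cross_eq_zero e N hΘd hr0 hr1, Complex.zero_re]
    have h2 : ∫ θ in (0 : ℝ)..2 * π, ‖∑ n ∈ range N, e n * circPt r θ ^ n‖ ^ 2 ≤
        ∫ θ in (0 : ℝ)..2 * π, ‖G (circPt r θ)‖ ^ 2 := by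
      -- pointwise `‖u + v‖² = ‖u‖² + 2 Re(conj u · v) + ‖v‖²` (as in the tree's
      -- `Literature.Barriers.RiemannHypothesis.BoxCert.norm_add_sq_eq`, inlined here)
      have hnorm : ∀ u w : ℂ, ‖u + w‖ ^ 2 = ‖u‖ ^ 2 + 2 * (conj u * w).re + ‖w‖ ^ 2 := by
        intro u w
        rw [Complex.sq_norm, Complex.sq_norm, Complex.sq_norm, Complex.normSq_add]
        have : (u * conj w).re = (conj u * w).re := by
          rw [← Complex.conj_re (u * conj w), map_mul, Complex.conj_conj, mul_comm]
        rw [this]; ring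
      have hsplit : ∀ θ : ℝ, ‖G (circPt r θ)‖ ^ 2 =
          ‖∑ n ∈ range N, e n * circPt r θ ^ n‖ ^ 2 +
            (2 * (conj (∑ n ∈ range N, e n * circPt r θ ^ n) * v θ).re + ‖v θ‖ ^ 2) := by
        intro θ; rw [hdec θ, hnorm]; ring
      simp_rw [hsplit]
      have hi1 : IntervalIntegrable (fun θ : ℝ => ‖∑ n ∈ range N, e n * circPt r θ ^ n‖ ^ 2)
          volume 0 (2 * π) := Continuous.intervalIntegrable (by fun_prop) _ _
      have hi2 : IntervalIntegrable
          (fun θ : ℝ => 2 * (conj (∑ n ∈ range N, e n * circPt r θ ^ n) * v θ).re) volume 0 (2 * π) :=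
        Continuous.intervalIntegrable (by fun_prop) _ _
      have hi3 : IntervalIntegrable (fun θ : ℝ => ‖v θ‖ ^ 2) volume 0 (2 * π) :=
        Continuous.intervalIntegrable (by fun_prop) _ _
      rw [intervalIntegral.integral_add hi1 (hi2.add hi3), intervalIntegral.integral_add hi2 hi3,
        intervalIntegral.integral_const_mul, hcross, mul_zero, zero_add]
      have : 0 ≤ ∫ θ in (0 : ℝ)..2 * π, ‖v θ‖ ^ 2 :=
        intervalIntegral.integral_nonneg (by positivity) (fun θ _ => by positivity)
      linarith
    -- (3) `∫ ‖G‖² ≤ ∫ ‖p‖²`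
    have h3 : ∫ θ in (0 : ℝ)..2 * π, ‖G (circPt r θ)‖ ^ 2 ≤
        ∫ θ in (0 : ℝ)..2 * π, ‖p.eval (circPt r θ)‖ ^ 2 := by
      apply intervalIntegral.integral_mono_on (by positivity)
      · exact Continuous.intervalIntegrable ((hpc.mul hFc).norm.pow 2) _ _
      · exact Continuous.intervalIntegrable (hpc.norm.pow 2) _ _
      · intro θ _
        rw [hGdef]; simp only
        rw [norm_mul]
        have hF1 : ‖F (circPt r θ)‖ ≤ 1 := hF.norm_le _ (hmem θ)
        have hp0 : 0 ≤ ‖p.eval (circPt r θ)‖ := norm_nonneg _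
        have : ‖p.eval (circPt r θ)‖ * ‖F (circPt r θ)‖ ≤ ‖p.eval (circPt r θ)‖ * 1 := by gcongr
        rw [mul_one] at this
        exact pow_le_pow_left₀ (by positivity) this 2
    -- (4) `∫ ‖p‖² = 2π Σ ‖pₙ‖² r^{2n} ≤ 2π B`
    have h4 : ∫ θ in (0 : ℝ)..2 * π, ‖p.eval (circPt r θ)‖ ^ 2 ≤ 2 * π * B := by
      have hev : ∀ θ : ℝ, p.eval (circPt r θ) =
          ∑ n ∈ range (p.natDegree + 1), p.coeff n * circPt r θ ^ n :=
        fun θ => eval_eq_sum_range (circPt r θ)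
      simp_rw [hev]
      rw [integral_norm_sq_sum (fun n => p.coeff n) (p.natDegree + 1) r, hB]
      gcongr with n _
      have : r ^ (2 * n) ≤ 1 := pow_le_one₀ hr0.le hr1.le
      calc ‖p.coeff n‖ ^ 2 * r ^ (2 * n) ≤ ‖p.coeff n‖ ^ 2 * 1 := by gcongr
        _ = ‖p.coeff n‖ ^ 2 := mul_one _
    have hchain : 2 * π * ∑ n ∈ range N, ‖e n‖ ^ 2 * r ^ (2 * n) ≤ 2 * π * B := by
      rw [← h1]; linarith
    exact le_of_mul_le_mul_left hchain (by positivity)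
  -- let `r → 1`
  have hcont : ContinuousAt (fun r : ℝ => ∑ n ∈ range N, ‖e n‖ ^ 2 * r ^ (2 * n)) 1 := by fun_prop
  have htend : Tendsto (fun r : ℝ => ∑ n ∈ range N, ‖e n‖ ^ 2 * r ^ (2 * n)) (𝓝[<] (1 : ℝ))
      (𝓝 (∑ n ∈ range N, ‖e n‖ ^ 2)) := by
    have := hcont.tendsto.mono_left (nhdsWithin_le_nhds (s := Iio (1 : ℝ)))
    simpa using this
  have hev : ∀ᶠ r in 𝓝[<] (1 : ℝ), ∑ n ∈ range N, ‖e n‖ ^ 2 * r ^ (2 * n) ≤ B := by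
    filter_upwards [Ioo_mem_nhdsLT (show (0 : ℝ) < 1 by norm_num)] with r hr
    exact hcirc r hr.1 hr.2
  exact le_of_tendsto htend hev

end

end Literature.Analysis.Complex

end Part6

/-!
## Part 7 — port of `Summits/Ventures/DiscreteObjects/Mahler/Parseval4.lean`

# Smyth's theorem: the four-term Parseval inequality (venture `DiscreteObjects`, target L)

Cell `pub-namedobj`, seat `pub-namedobj-mahler` (gen 8). Framing: lottery ticket; floor = certified
bounds/negative ranges.

The function-theoretic heart of [McKee–Smyth, *Around the Unit Circle*, §12.2.1–12.2.3] (Smyth 1971),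
abstracted from the polynomial: a pair of Schur functions `f, g` with REAL Taylor coefficients
`fₙ, gₙ`, `f₀ = g₀ = c ∈ (0,1)` (`SmythData f g c`), linked by the "nonreciprocity relations"

  `fₙ = gₙ + a·g_{n-k}·[k ≤ n] + b·c·[n = ℓ]`   (`n ≤ ℓ`, integers `a, b ≠ 0`, `1 ≤ k < ℓ`)

(which is what `f·P* = ε P·g` and `εP = P*(1 + aX^k + bX^ℓ) + O(X^{ℓ+1})` give), must have
`c² + c³ ≤ 1`, i.e. `M = 1/c` satisfies `M³ ≥ M + 1`, i.e. `M ≥ θ₀` (`smyth_analytic`).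

This file: `jetCoeff_pow_mul'`, `jetCoeff_conj_of_symm` (conjugation symmetry ⇒ real Taylor
coefficients), `jetCoeff_comb4`, and `parseval4` — the four-term Parseval inequality for a Schur
function with real coefficients (from `hardy_contraction`), the analytic input of §12.2.2.
The case analysis itself is in `SmythAnalytic.lean`.
-/

section Part7

namespace Literature.Analysis.Complex

open Literature.Analysis.Complex.SchurAlgorithm

open _root_.Polynomial _root_.Metric _root_.Set _root_.Filter _root_.Topology _root_.Finset
open scoped ComplexConjugate

noncomputable section

/-! ### More on Taylor coefficients -/

/-- Coefficients of `z^m · F`: shifted by `m`, zero below `m`.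
[cite: MckeeSmyth2021, §12.2.2 (Parseval step) p.209] -/
theorem jetCoeff_pow_mul' {r : ℝ} (hr : 0 < r) {F : ℂ → ℂ} (hF : DifferentiableOn ℂ F (ball 0 r))
    (m n : ℕ) : jetCoeff (fun z => z ^ m * F z) n = if m ≤ n then jetCoeff F (n - m) else 0 := by
  split_ifs with h
  · have := jetCoeff_pow_mul hr hF m (n - m)
    rw [Nat.sub_add_cancel h] at this
    exact this
  · push Not at h
    have hd : DifferentiableOn ℂ (fun z => z ^ m * F z) (ball 0 r) := (differentiableOn_id.pow m).mul hF
    have hc : ContinuousAt F 0 := (hF.differentiableAt (ball_mem_nhds _ hr)).continuousAt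
    have := jetCoeff_unique' (N := m) (c := fun _ => 0) hr hd hc (fun z _ => by simp) n h
    simpa using this

/-- A function with the symmetry `F (z̄) = conj (F z)` has real Taylor coefficients.
[cite: MckeeSmyth2021, §12.2.2 (Parseval step) p.209] -/
theorem jetCoeff_conj_of_symm {r : ℝ} (hr : 0 < r) {F : ℂ → ℂ} (hF : DifferentiableOn ℂ F (ball 0 r))
    (hsym : ∀ z, F (conj z) = conj (F z)) (n : ℕ) : conj (jetCoeff F n) = jetCoeff F n := by
  set ψ := jetTail F (n + 1) with hψ
  have hψc : ContinuousAt ψ 0 := continuousAt_jetTail hr hF (n + 1)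
  have hψ'c : ContinuousAt (fun z => conj (ψ (conj z))) 0 := by
    have h1 : ContinuousAt (fun z : ℂ => conj z) 0 := Complex.continuous_conj.continuousAt
    have h2 : ContinuousAt ψ (conj (0 : ℂ)) := by rw [map_zero]; exact hψc
    have h3 : ContinuousAt (fun z => ψ (conj z)) 0 := ContinuousAt.comp (g := ψ) h2 h1
    exact (Complex.continuous_conj.continuousAt).comp h3
  have hexp : ∀ z ∈ ball (0 : ℂ) r,
      F z = (∑ m ∈ range (n + 1), conj (jetCoeff F m) * z ^ m) + z ^ (n + 1) * conj (ψ (conj z)) := by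
    intro z _
    have h := jet_eq F (n + 1) (conj z)
    have h2 : F z = conj (F (conj z)) := by rw [hsym, Complex.conj_conj]
    rw [h2, h, map_add, map_mul, map_sum, map_pow, Complex.conj_conj]
    congr 1
    apply Finset.sum_congr rfl
    intro m _
    rw [map_mul, map_pow, Complex.conj_conj]
  have := jetCoeff_unique' hr (F := F) (c := fun m => conj (jetCoeff F m)) hF hψ'c hexp n
    (Nat.lt_add_one n)
  exact this.symm

/-- Coefficients of a four-term combination `u₀F + u₁z^iF + u₂z^jF + u₃z^lF`.
[cite: MckeeSmyth2021, §12.2.2 (Parseval step) p.209] -/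
theorem jetCoeff_comb4 {F : ℂ → ℂ} (hF : DifferentiableOn ℂ F (ball 0 1)) (u₀ u₁ u₂ u₃ : ℂ)
    (i j l n : ℕ) :
    jetCoeff (fun z => u₀ * F z + u₁ * (z ^ i * F z) + u₂ * (z ^ j * F z) + u₃ * (z ^ l * F z)) n =
      u₀ * jetCoeff F n + u₁ * (if i ≤ n then jetCoeff F (n - i) else 0) +
        u₂ * (if j ≤ n then jetCoeff F (n - j) else 0) +
        u₃ * (if l ≤ n then jetCoeff F (n - l) else 0) := by
  have hd : ∀ m : ℕ, DifferentiableOn ℂ (fun z => z ^ m * F z) (ball 0 1) :=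
    fun m => (differentiableOn_id.pow m).mul hF
  have dA : DifferentiableOn ℂ (fun z => u₀ * F z) (ball 0 1) := hF.const_mul u₀
  have dB : DifferentiableOn ℂ (fun z => u₁ * (z ^ i * F z)) (ball 0 1) := (hd i).const_mul u₁
  have dC : DifferentiableOn ℂ (fun z => u₂ * (z ^ j * F z)) (ball 0 1) := (hd j).const_mul u₂
  have dD : DifferentiableOn ℂ (fun z => u₃ * (z ^ l * F z)) (ball 0 1) := (hd l).const_mul u₃
  have dAB : DifferentiableOn ℂ (fun z => u₀ * F z + u₁ * (z ^ i * F z)) (ball 0 1) := dA.add dB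
  have dABC : DifferentiableOn ℂ (fun z => u₀ * F z + u₁ * (z ^ i * F z) + u₂ * (z ^ j * F z))
      (ball 0 1) := dAB.add dC
  rw [jetCoeff_add one_pos dABC dD, jetCoeff_add one_pos dAB dC, jetCoeff_add one_pos dA dB,
    jetCoeff_const_mul one_pos hF, jetCoeff_const_mul one_pos (hd i),
    jetCoeff_const_mul one_pos (hd j), jetCoeff_const_mul one_pos (hd l),
    jetCoeff_pow_mul' one_pos hF, jetCoeff_pow_mul' one_pos hF, jetCoeff_pow_mul' one_pos hF]

/-- The squared norms of the coefficients of `u₀ + u₁X^i + u₂X^j + u₃X^l` (`0 < i < j < l`, real `u`).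
[cite: MckeeSmyth2021, §12.2.2 (Parseval step) p.209] -/
theorem norm_sq_coeff_comb4 (u₀ u₁ u₂ u₃ : ℝ) {i j l : ℕ} (hi : 0 < i) (hij : i < j) (hjl : j < l)
    (n : ℕ) :
    ‖(C (u₀ : ℂ) + C (u₁ : ℂ) * X ^ i + C (u₂ : ℂ) * X ^ j + C (u₃ : ℂ) * X ^ l).coeff n‖ ^ 2 =
      (if n = 0 then u₀ ^ 2 else 0) + (if n = i then u₁ ^ 2 else 0) + (if n = j then u₂ ^ 2 else 0) +
        (if n = l then u₃ ^ 2 else 0) := by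
  simp only [coeff_add, coeff_C, coeff_C_mul_X_pow]
  by_cases h0 : n = 0
  · subst h0
    simp [hi.ne, (hi.trans hij).ne, ((hi.trans hij).trans hjl).ne]
  by_cases h1 : n = i
  · subst h1
    simp [h0, hij.ne, (hij.trans hjl).ne]
  by_cases h2 : n = j
  · subst h2
    simp [h0, hij.ne', hjl.ne]
  by_cases h3 : n = l
  · subst h3
    simp [h0, (hij.trans hjl).ne', hjl.ne']
  simp [h0, h1, h2, h3]

/-- **Four-term Parseval inequality.**  For a Schur function `F` with real Taylor coefficients
`Rₙ` and real `u₀,…,u₃`, `0 < i < j < l`: the coefficients of `(u₀ + u₁zⁱ + u₂zʲ + u₃zˡ)·F` in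
degrees `0, i, j, l` have sum of squares at most `u₀² + u₁² + u₂² + u₃²`.
[cite: MckeeSmyth2021, §12.2.2 (Parseval step) p.209] -/
theorem parseval4 {F : ℂ → ℂ} (hF : IsSchurClass F) (hreal : ∀ n, conj (jetCoeff F n) = jetCoeff F n)
    (u₀ u₁ u₂ u₃ : ℝ) {i j l : ℕ} (hi : 0 < i) (hij : i < j) (hjl : j < l) :
    (u₀ * (jetCoeff F 0).re) ^ 2 + (u₀ * (jetCoeff F i).re + u₁ * (jetCoeff F 0).re) ^ 2 +
      (u₀ * (jetCoeff F j).re + u₁ * (jetCoeff F (j - i)).re + u₂ * (jetCoeff F 0).re) ^ 2 +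
      (u₀ * (jetCoeff F l).re + u₁ * (jetCoeff F (l - i)).re + u₂ * (jetCoeff F (l - j)).re +
        u₃ * (jetCoeff F 0).re) ^ 2 ≤ u₀ ^ 2 + u₁ ^ 2 + u₂ ^ 2 + u₃ ^ 2 := by
  set R : ℕ → ℝ := fun n => (jetCoeff F n).re with hR
  have hre : ∀ n, jetCoeff F n = ((R n : ℝ) : ℂ) := fun n => (Complex.conj_eq_iff_re.mp (hreal n)).symm
  set p : ℂ[X] := C (u₀ : ℂ) + C (u₁ : ℂ) * X ^ i + C (u₂ : ℂ) * X ^ j + C (u₃ : ℂ) * X ^ l with hp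
  -- degree bound
  have hdeg : p.natDegree + 1 ≤ l + 1 := by
    have h1 : (C (u₀ : ℂ)).natDegree ≤ l := by rw [natDegree_C]; omega
    have h2 : (C (u₁ : ℂ) * X ^ i).natDegree ≤ l := (natDegree_C_mul_X_pow_le _ _).trans (by omega)
    have h3 : (C (u₂ : ℂ) * X ^ j).natDegree ≤ l := (natDegree_C_mul_X_pow_le _ _).trans (by omega)
    have h4 : (C (u₃ : ℂ) * X ^ l).natDegree ≤ l := natDegree_C_mul_X_pow_le _ _
    have := (natDegree_add_le _ _).trans (max_le ((natDegree_add_le _ _).trans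
      (max_le ((natDegree_add_le _ _).trans (max_le h1 h2)) h3)) h4)
    rw [hp]; omega
  -- Hardy contraction
  have hH := hardy_contraction hF p (l + 1)
  -- the right-hand side
  have hRHS : ∑ n ∈ range (p.natDegree + 1), ‖p.coeff n‖ ^ 2 ≤ u₀ ^ 2 + u₁ ^ 2 + u₂ ^ 2 + u₃ ^ 2 := by
    have hsub : range (p.natDegree + 1) ⊆ range (l + 1) := range_subset_range.mpr hdeg
    have h1 : ∑ n ∈ range (p.natDegree + 1), ‖p.coeff n‖ ^ 2 ≤ ∑ n ∈ range (l + 1), ‖p.coeff n‖ ^ 2 :=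
      sum_le_sum_of_subset_of_nonneg hsub (fun n _ _ => by positivity)
    have h2 : ∑ n ∈ range (l + 1), ‖p.coeff n‖ ^ 2 = u₀ ^ 2 + u₁ ^ 2 + u₂ ^ 2 + u₃ ^ 2 := by
      rw [hp]
      simp_rw [norm_sq_coeff_comb4 u₀ u₁ u₂ u₃ hi hij hjl]
      rw [sum_add_distrib, sum_add_distrib, sum_add_distrib, sum_ite_eq', sum_ite_eq', sum_ite_eq',
        sum_ite_eq']
      simp only [Finset.mem_range]
      rw [if_pos (by omega), if_pos (by omega), if_pos (by omega), if_pos (by omega)]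
    linarith
  -- the left-hand side: the four coefficients
  have hfun : (fun z => p.eval z * F z) =
      fun z => (u₀ : ℂ) * F z + (u₁ : ℂ) * (z ^ i * F z) + (u₂ : ℂ) * (z ^ j * F z) +
        (u₃ : ℂ) * (z ^ l * F z) := by
    funext z; rw [hp]; simp only [eval_add, eval_mul, eval_C, eval_pow, eval_X]; ring
  have hcoef : ∀ n, jetCoeff (fun z => p.eval z * F z) n =
      (u₀ : ℂ) * jetCoeff F n + (u₁ : ℂ) * (if i ≤ n then jetCoeff F (n - i) else 0) +
        (u₂ : ℂ) * (if j ≤ n then jetCoeff F (n - j) else 0) +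
        (u₃ : ℂ) * (if l ≤ n then jetCoeff F (n - l) else 0) := by
    intro n; rw [hfun]; exact jetCoeff_comb4 hF.differentiableOn _ _ _ _ i j l n
  set e : ℕ → ℂ := fun n => jetCoeff (fun z => p.eval z * F z) n with he
  have he0 : e 0 = ((u₀ * R 0 : ℝ) : ℂ) := by
    rw [he]; simp only; rw [hcoef 0, if_neg (by omega), if_neg (by omega), if_neg (by omega), hre 0]
    push_cast; ring
  have hei : e i = ((u₀ * R i + u₁ * R 0 : ℝ) : ℂ) := by
    rw [he]; simp only
    rw [hcoef i, if_pos le_rfl, if_neg (by omega), if_neg (by omega), Nat.sub_self, hre i, hre 0]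
    push_cast; ring
  have hej : e j = ((u₀ * R j + u₁ * R (j - i) + u₂ * R 0 : ℝ) : ℂ) := by
    rw [he]; simp only
    rw [hcoef j, if_pos hij.le, if_pos le_rfl, if_neg (by omega), Nat.sub_self, hre j, hre (j - i),
      hre 0]
    push_cast; ring
  have hel : e l = ((u₀ * R l + u₁ * R (l - i) + u₂ * R (l - j) + u₃ * R 0 : ℝ) : ℂ) := by
    rw [he]; simp only
    rw [hcoef l, if_pos (hij.trans hjl).le, if_pos hjl.le, if_pos le_rfl, Nat.sub_self, hre l,
      hre (l - i), hre (l - j), hre 0]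
    push_cast; ring
  -- restrict the sum to the four indices
  have hnot0 : (0 : ℕ) ∉ ({i, j, l} : Finset ℕ) := by simp; omega
  have hnoti : i ∉ ({j, l} : Finset ℕ) := by simp; omega
  have hnotj : j ∉ ({l} : Finset ℕ) := by simp; omega
  have hsub : ({0, i, j, l} : Finset ℕ) ⊆ range (l + 1) := by
    intro n hn
    simp only [Finset.mem_insert, Finset.mem_singleton] at hn
    simp only [Finset.mem_range]; omega
  have hLHS : ‖e 0‖ ^ 2 + ‖e i‖ ^ 2 + ‖e j‖ ^ 2 + ‖e l‖ ^ 2 ≤ ∑ n ∈ range (l + 1), ‖e n‖ ^ 2 := by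
    have h := sum_le_sum_of_subset_of_nonneg hsub
      (f := fun n => ‖e n‖ ^ 2) (fun n _ _ => by positivity)
    rw [sum_insert hnot0, sum_insert hnoti, sum_insert hnotj, sum_singleton] at h
    linarith
  have hsq : ∀ u : ℝ, ‖(u : ℂ)‖ ^ 2 = u ^ 2 := fun u => by rw [Complex.norm_real, Real.norm_eq_abs, sq_abs]
  rw [he0, hei, hej, hel, hsq, hsq, hsq, hsq] at hLHS
  have hH' : ∑ n ∈ range (l + 1), ‖e n‖ ^ 2 ≤ u₀ ^ 2 + u₁ ^ 2 + u₂ ^ 2 + u₃ ^ 2 := hH.trans hRHS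
  exact hLHS.trans hH'

end

end Literature.Analysis.Complex

end Part7

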